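import Summits.HodgeConjecture.HodgeConjecture.Theorems.LinearSystemTorelliMiddleDivisorSupportFourfoldOfDominantQbarEnvelope
import Summits.HodgeConjecture.HodgeConjecture.Theorems.LinearSystemTorelliMiddleDivisorSupportFourfoldStubDominantEnvelope
import Summits.HodgeConjecture.HodgeConjecture.Theorems.LinearSystemTorelliMiddleDivisorSupportFourfoldStubFiniteMonodromyAtGenericSpread
import Literature.AlgebraicGeometry.HodgeTheory.HodgeGenericQbarDescent
import Literature.AlgebraicGeometry.FundamentalGroup.RiemannExistenceQbarDescentProofs
import Literature.AlgebraicGeometry.HodgeTheory.IsoTransport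
import Summits.HodgeConjecture.HodgeConjecture.Theorems.LinearSystemTorelliMiddleDivisorSupportFourfoldStubQbarDivisorSupportLowDim
import Literature.AlgebraicGeometry.HodgeTheory.InvariantClassesFromTotalSpaceHolds
import Literature.AlgebraicGeometry.FundamentalGroup.RiemannExistenceCovering
import Summits.HodgeConjecture.HodgeConjecture.Theorems.LinearSystemTorelliMiddleDivisorSupportFourfoldStubConnectedWeakDescent
import Literature.AlgebraicGeometry.FundamentalGroup.FiniteEtaleQbarWeakDescent
import Literature.AlgebraicGeometry.HodgeTheory.AlgebraicCyclesDefinedOverQbarProofs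
import Literature.AlgebraicGeometry.HodgeTheory.RelativeHyperplaneClassHodgeRiemann
import Literature.AlgebraicGeometry.HodgeTheory.HodgeGenericQbarDescentProofs
import Literature.AlgebraicGeometry.HodgeTheory.SpreadingOutQbarFamilyProofs
import Literature.AlgebraicGeometry.HodgeTheory.QbarGenericPointsDense
import Summits.HodgeConjecture.HodgeConjecture.Theorems.LimitExtensionDivisorInduction
import Literature.AlgebraicGeometry.HodgeTheory.LefschetzOneOneHolds
import Literature.AlgebraicGeometry.HodgeTheory.HodgeTypeDimension
import Literature.AlgebraicGeometry.HodgeTheory.HodgeGenericQbarDescentCompactification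
import Summits.HodgeConjecture.HodgeConjecture.Theorems.LinearSystemTorelliMiddleDivisorSupportFourfoldTypeStabilityOfFiniteMonodromy
import Literature.AlgebraicGeometry.HodgeTheory.RestrictionImageOfCompactification
import Literature.AlgebraicGeometry.FundamentalGroup.RiemannExistenceNormalSeparating
import Literature.AlgebraicGeometry.HodgeTheory.RestrictionImageOfCompactificationProofs
import Literature.AlgebraicGeometry.FundamentalGroup.RiemannExistenceSeparatingIff
import Literature.AlgebraicGeometry.HodgeTheory.ContinuationLoopsZariskiOpen
import Literature.AlgebraicGeometry.FundamentalGroup.RiemannExistenceSeparatingLowDim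

/-!
# Skeleton v18 — line `IdeatorFiveSketch` (idea `weakly-nonfactor-descent`) for crux stmt-HodgeConjecture-2409
`LinearSystemTorelli.MiddleDivisorSupportFourfold` (lead c19, continuation).

v18 = v17 (below) with ONE reshape on the C-side (lead c19), integrating the tree event of
2026-08-17T02:27Z — the Riemann-existence fact seat's LAST hook before it released the fact with
the verdict "dimension `≥ 2`: theories absent":
`FundamentalGroup.riemannExistence_qbarDescent_of_finiteIndex_of_locallyAlgebraicSeparating`, the
ZARISKI-LOCAL separating form ("the shape produced by weighted `L²` estimates in étale coordinates
on an affine neighbourhood of `P₀`"). The registered covering stub is now **C1'''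
`stub_locallyAlgebraicSeparatingSmoothAffineDimGeTwo`**: for `S` smooth irreducible affine of
relative dimension `n + 2`, `q : T → S(ℂ)` a finite-fibred covering and `P₀ ∈ S(ℂ)` — an affine open
`U ∋ P₀`, `h : T → ℂ` continuous on `q⁻¹(U(ℂ))` and injective on `q⁻¹(P₀)`, and a non-zero
`F ∈ Γ(S, U)[τ]` killing `h` along `q` over `U(ℂ)`. C1''' ⟸ C1'' with `U = ⊤`
(`stub_locallyAlgebraicSeparatingSmoothAffineDimGeTwo_of_algebraicSeparating`, sorry-free) and v17's
C1'' `stub_algebraicSeparatingSmoothAffineDimGeTwo` keeps its name and signature and is DERIVED from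
C1''' FOR THE SAME `S` (Theorem B′ on `U`, Theorem A, Chinese remainders on the algebraised cover:
`ContinuousRational.exists_charPoly_of_algebraic`, `CharPoly.exists_finite_etale_homeomorph_of_charPoly_of_isCoveringMap`,
`integralSeparating_of_isFinite` — all PROVED in the tree), so the reshape is a strict weakening
that loses nothing and C1', C, B, the composition are untouched. Open stubs: A'', C1''', D, E —
sorries 4. Staffing note (lead c19): no fact claim is open any more on
`riemannExistence_finiteCovering` (seat released 2026-08-17T02:xxZ), none on
`voisin2003_rangeRestrict_eq_of_compactification` / `deligne_globalInvariantCycles`, and stmt-16363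
is unclaimed — C1''' and D are classical theorems WITHOUT a live seat.

v17 = v16 (below) with ONE reshape on the C-side (lead c18), integrating the tree event of
2026-08-17T01:5xZ — the Riemann-existence seat PROVED the CURVE case of the transcendental half
of SGA1 XII 5.1 (`FundamentalGroup.integralSeparating_of_smoothOfRelativeDimension_one`,
`riemannExistence_smoothAffineCurve`; Forster §8/§14 + Noether projection): the registered covering
stub is now **C1'' `stub_algebraicSeparatingSmoothAffineDimGeTwo` — algebraic separating functions
on finite coverings of smooth irreducible affine `ℂ`-schemes OF RELATIVE DIMENSION `≥ 2`**
(v15/v16's C1' with the extra hypothesis `SmoothOfRelativeDimension (n + 2) S.hom`). C1'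
`stub_algebraicSeparatingSmoothAffine` keeps its name and signature and is DERIVED (no sorry): a
smooth irreducible `S` has a relative dimension `n` (`Motives.exists_smoothOfRelativeDimension_of_smooth`);
`n ≤ 1` is the tree's `FundamentalGroup.algebraicSeparating_of_smoothOfRelativeDimension_le_one`
(lead c18, `RiemannExistenceSeparatingLowDim.lean`: relative dimension `0` — discrete coverings,
an integer polynomial — and `1` — the curve case above), `n ≥ 2` is C1''. C1'' ⟸ C1'
(`stub_algebraicSeparatingSmoothAffineDimGeTwo_of_algebraicSeparatingSmoothAffine`, sorry-free), so
the reshape is a strict weakening that loses nothing; the line's covering debt is now exactly the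
all-dimensional (`≥ 2`) smooth affine case of Riemann existence (Grauert–Remmert / GAGA on an snc
compactification), the RET seat's live residual. Open stubs: A'', C1'', D, E — sorries 4.

v16 = v15 (below) with ONE reshape on the A-side (lead c17, same cycle): the registered transcendence kernel
is now **A'' `stub_typeStabilityAtQbarGenericZariskiLocal` — type stability at `ℚ̄`-generic points, ZARISKI-LOCALLY
ON THE BASE**: for each rational `(2,2)`-class `α` at a `ℚ̄`-generic point `s` there is SOME proper closed
`Z₀ ⊊ S₀` such that the continuations of `α` along loops at `s` AVOIDING (the preimage of) `Z₀` are of type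
`(2,2)`. A'' is strictly weaker than v10–v15's A' (take `Z₀ = ∅`: `stub_typeStabilityAtQbarGenericZariskiLocal_of_typeStability`)
and gives A' back UNCONDITIONALLY by the landed loop-shrinking theorem
`IsContinuationAlong.exists_loop_forall_base_pt_notMem_of_qbarFamily` (p136872, from p136606: connected covers
of a smooth variety stay connected over a dense Zariski open, applied to the path-component covering of the
espace étalé) — `stub_typeStabilityAtQbarGeneric` keeps its name and signature and is now DERIVED (no sorry), so
the composition is untouched. Open stubs: A'', C1', D, E — sorries 4.

v15 = v14 (below) with ONE reshape on the C-side and one sorry-free link on the D-side (lead c17):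
* **C1 → C1' (strictly WEAKER registered stub).** v6–v14 carried Riemann's existence theorem in
  covering form for ALL quasi-projective `ℂ`-schemes (the named fact
  `FundamentalGroup.riemannExistence_finiteCovering`, whose residual is separating functions on finite
  coverings of NORMAL affine varieties). The composition consumes it only through the named fact C
  (`riemannExistence_qbarDescent_of_finiteIndex`, antecedent of B), i.e. over SMOOTH irreducible bases
  `S₀ ⊗_σ ℂ`; the tree's `riemannExistence_qbarDescent_of_finiteIndex_of_algebraicSeparating`
  (`RiemannExistenceQbarDescentProofs`, Theorems A/B′ + Zariski-localness + weak descent, all PROVED)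
  derives C from the existence of ALGEBRAIC SEPARATING FUNCTIONS on finite coverings of smooth
  irreducible AFFINE `ℂ`-schemes — the new registered stub C1' `stub_algebraicSeparatingSmoothAffine`
  (verbatim that hypothesis; = the right-hand side of the tree's
  `riemannExistence_smooth_iff_algebraicSeparating`, i.e. EQUIVALENT to Riemann existence for smooth
  quasi-projective bases). C1' ⟸ C1 (`stub_algebraicSeparatingSmoothAffine_of_riemannExistence_finiteCovering`,
  smooth ⟹ normal, monic ⟹ non-zero) and C1' ⟸ Riemann existence for smooth quasi-projective bases
  (`…_of_riemannExistence_smooth`), both sorry-free below; so the reshape loses nothing and the line's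
  covering debt is now the SMOOTH case only (complex-manifold coverings; no normal analytic spaces).
* **D's residue is the simple-normal-crossings core of Voisin II Prop. 4.23** (tree event
  2026-08-17T01:03Z, `RestrictionImageOfCompactificationProofs`: complex coefficients suffice, the
  compactification may be taken irreducible, then log-resolved by Kollár's algorithm — all PROVED):
  `stub_deligneGlobalInvariantCycles_of_snc` below derives stub D from the inclusion
  `Im(ι^*) ⊆ Im((ι ≫ i)^*)` for `Y →ι 𝒳 →i X'` with `X' ∖ i(𝒳)` an snc boundary (hypothesis `hSNC`,
  the setting of Deligne's logarithmic de Rham complex), via `voisin2003_rangeRestrict_eq_of_compactification_of_snc`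
  and `deligne_globalInvariantCycles_of_rangeRestrict`.
Open stubs: A' (T), C1', D, E — sorries 4; A', D, E byte-identical to v10–v14.

v14 = v13 (below) with NO change to the registered stubs (A', C1, D, E byte-identical; sorries 4) and
two sorry-free links by lead c15:
* the C1-side residue is ONE analytic existence statement: the named fact
  `FundamentalGroup.riemannExistence_finiteCovering` (stub C1) follows from the existence of INTEGRAL
  SEPARATING FUNCTIONS on finite coverings of normal affine varieties — the tree's
  `FundamentalGroup.riemannExistence_finiteCovering_of_integralSeparating`
  (`RiemannExistenceNormalSeparating.lean`, Literature seat, 2026-08-17T00:25Z: reduction to a normal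
  affine base by Milnor patching + the algebraisation Theorems A/B; the transcendental heart —
  Grauert–Remmert / GAGA / Hörmander — is exactly that existence statement), linked here as
  `stub_riemannExistenceComplex_of_integralSeparating`;
* WHERE the line's kernel T sits among the NAMED transcendence hypotheses: the crux follows from
  AH(4,2) ("rational `(2,2)`-classes on fourfolds are absolute Hodge", Deligne's question) with the
  EXISTING items stmt-1070 (`BoundaryReadout.HCOverNumberFields`) and stmt-15945
  (`BoundaryReadout.AbsoluteReduction` = Voisin 2007 Prop. 1.2, theorem in print, carried as a route
  item) — items only — and from WAH(4,2) (weakly absolute, Voisin 2007 Def. 2.1) with stmt-11596 modulo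
  the Literature named fact `voisin2007_hodgeConjecture_weaklyAbsolute_of_qbar`
  (`Theorems/LinearSystemTorelliMiddleDivisorSupportFourfoldOfAbsoluteHodge.lean`, p134157 ACCEPTED,
  commit 08d66b372ff9, two registered sub-goals). Mathematically AH ⟹ WAH ⟹ (Voisin 2007 Thm. 0.5 (2)
  / Lemma 1.4 + Cattani–Deligne–Kaplan: the Hodge-locus base of a weakly absolute class is defined over
  `ℚ̄`, and a `ℚ̄`-closed set through a `ℚ̄`-generic point is everything) ⟹ T, so the registered kernel
  T is the weakest of the three; these items-only paths are recorded below as a COMMENT (not restated),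
  so that the registered composition stays `MiddleDivisorSupportFourfold_of`.

v13 = v12 = v11 (below) with NO change to the registered stubs (A', C1, D, E byte-identical; sorries 4) and
two kernel-checked certificates by lead c14 (v12: the first; v13: both linked sorry-free):
* the A-side is EXACT inside the line: the registered kernel A' `stub_typeStabilityAtQbarGeneric` (T)
  FOLLOWS from the ∀-form of the old stub A (finite monodromy at `ℚ̄`-generic points) modulo the
  line's own classical debts C1 (`FundamentalGroup.riemannExistence_finiteCovering`) and D
  (`Theses.LinearSystemTorelli.DeligneGlobalInvariantCycles`) — `stub_typeStabilityAtQbarGeneric_of_forall_finite`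
  below, from `Theorems.linearSystemTorelli_typeStabilityAtQbarGeneric_of_forall_finite` (p132947,
  `Theorems/…TypeStabilityOfFiniteMonodromy.lean`, --supports 2409, registered sub-goal; proof: Voisin's
  finite-monodromy construction read for the CONJUGATES — lift the loop to the finite étale cover,
  `isContinuationAlong_globalSection` for the Hodge lift `i^* β` upstairs, push down by
  `IsContinuationAlong.baseChange`, uniqueness of continuations). With p127337 (A ⟸ A' unconditionally)
  the reshape v9 → v10 lost nothing modulo C1, D: pointwise, finite monodromy ↔ type stability
  (`Theorems.linearSystemTorelli_finite_setOf_isContinuationAlong_iff_forall_isOfHodgeType`).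
* the D-side residue is ONE printed statement: `deligne_globalInvariantCycles` (= stub D by `Iff.rfl`)
  follows from Voisin II Prop. 4.23 ALONE (the images of `Hᵏ(𝒳̄; ℚ)` and `Hᵏ(𝒳; ℚ)` in `Hᵏ(Y; ℚ)` agree
  for a closed smooth projective `Y ⊂ 𝒳 ⊂ 𝒳̄`), named as the Literature fact
  `voisin2003_rangeRestrict_eq_of_compactification` with `deligne_globalInvariantCycles_of_rangeRestrict`
  (Thm. 4.18 is the tree's theorem `deligne1968_invariantClass_fromTotalSpace_holds`) and
  `…_of_mixedHodge` (the fact is implied by the former residue {`existsDeligne`, Hodge II 3.2.17}) —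
  p133108 ACCEPTED (`Literature/AlgebraicGeometry/HodgeTheory/RestrictionImageOfCompactification.lean`,
  commit 50a39d0c2ec5), linked here as `stub_deligneGlobalInvariantCycles_of_rangeRestrict` (D's residue is now
  the discharge `voisin2003_rangeRestrict_eq_of_compactification_holds` of ONE printed proposition).

v11 = v10 (below) with NO change to the registered stubs (A', C1, D, E byte-identical; sorries 4) and
two kernel-checked TIGHTNESS / DEDUP certificates landed by lead c11 and linked here sorry-free:
* the E-side is EXACT: the registered sector stub E `stub_qbarDivisorSupportCodimTwo` is EQUIVALENT
  (not merely implied by) the codimension-2 slice of `PeriodDeficiency.HodgeConjectureQbar`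
  (stmt-11596) — `stub_qbarDivisorSupportCodimTwo_iff_hcQbarCodimTwo` below, from
  `Theorems.linearSystemTorelli_stub_qbarDivisorSupportCodimTwo_iff` (p130143: E ⟹ HC/`ℚ̄`(·,2) by the
  route's PROVED `DivisorInduction` at `p = 2` + Lefschetz `(1,1)`; ⟸ by Charles–Schnell, discharged),
  so the `ℚ̄`-rationality of the supporting divisor is automatic and E cannot be cut below HC/`ℚ̄`(·,2);
* an ITEMS-ONLY closure path: crux ⟸ A' ∧ `PeriodDeficiency.FiniteMonodromyAlgebraicOfQbar`
  (stmt-15380, Voisin's finite-monodromy step, which packages the classical debts C1, D and Fulton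
  inside one existing item) ∧ stmt-11596 — landed as `Theorems.linearSystemTorelli_middleDivisorSupportFourfold_of_typeStability_of_finiteMonodromyAlgebraicOfQbar`
  (p130292; recorded below as a comment, not restated, so that the registered composition stays `MiddleDivisorSupportFourfold_of`) (landed as `Theorems.linearSystemTorelli_middleDivisorSupportFourfold_of_typeStability_of_finiteMonodromyAlgebraicOfQbar`);
  the registered composition `MiddleDivisorSupportFourfold_of` (A', C1, D, E) is unchanged.
Also landed (lead c11): the all-`p` two-debt residue for the sister support item stmt-1081
(`Theorems.linearSystemTorelli_middleDivisorSupport_of_typeStability`, p130212).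

v10 = v9 (below) with ONE reshape on the A-side, which has become UNCONDITIONAL: the Hodge–Riemann
input `hHR` of the tree's `bku_finite_monodromyOrbit_of_isHodgeGenericIn_of_inputs` is PROVED
(`hodgeRiemann_polarizationForm_qbarFamily`, `RelativeHyperplaneClassHodgeRiemann.lean`), so with the
tree's lattice finiteness (`finite_setOf_isContinuationAlong_of_norm_eq_baseChangeHom`), polarization
invariance (`polarizationForm_transportFun_self`) and the continuation/transport bridge
(`setOf_isContinuationAlong_eq_range_transportFun`) the old stub A `stub_finiteMonodromyAtGenericSpread`
(finite monodromy at the `ℚ̄`-generic spread point) follows from the NEW registered stub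
A' `stub_typeStabilityAtQbarGeneric` — "in a smooth projective `ℚ̄`-family of fourfolds, at a point
over the generic point of the smooth irreducible base, every loop-continuation of a rational
`(2,2)`-class is of type `(2,2)`" (the Hodge locus of the class through the `ℚ̄`-generic point is
everything) — by the LANDED helper `Theorems.stub_finiteMonodromyAtGenericSpread_of_typeStabilityAtQbarGeneric`
(lead c10, p127337, `Theorems/…StubFiniteMonodromyOfTypeStability.lean`, --supports 2409; with the
general unconditional lemma "a type-stable rational class has finite monodromy orbit",
`Theorems.linearSystemTorelli_finite_setOf_isContinuationAlong_of_forall_isOfHodgeType`; the skeleton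
inlines the same proofs — `finite_setOf_isContinuationAlong_of_forall_isOfHodgeType` below — so that it
imports only Literature files and elaborates independently of the farm's build of that module).  A' is the
exact transcendence kernel of the line and is WEAKER than v9's antecedent of A: it follows from
stmt-11597 ∧ stmt-11595 ∧ the Deligne–André type-stability input `hType` of
`bku_finite_monodromyOrbit_of_isHodgeGenericIn_of_hType` (certificate
`stub_typeStabilityAtQbarGeneric_of_qbarGenericIsHodgeGeneric_of_hType` below, landed as
`Theorems.linearSystemTorelli_typeStabilityAtQbarGeneric_of_qbarGenericIsHodgeGeneric_of_hType`), and
from HC(4,2).  A keeps its name and signature and is now DERIVED (no sorry); open stubs: A', C1, D, E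
— sorries 4; signatures of C1, D, E byte-identical to v9.  The line's kernel-checked residue drops
from three classical debts to TWO: crux ⟸ A' ∧ stmt-11596 modulo {Riemann existence over `ℂ`
(C1), Deligne's partie fixe (D = stmt-16363)}
(`Theorems.linearSystemTorelli_middleDivisorSupportFourfold_of_lineResidue_of_typeStability`, lead c10).

v9 (lead c9) = v8 (below) with stub C2' `stub_connectedWeakDescentQbar` PROVED and LANDED
(`Theorems.stub_connectedWeakDescentQbar`,
`Theorems/LinearSystemTorelliMiddleDivisorSupportFourfoldStubConnectedWeakDescentQbar.lean`, lead c9,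
p126502, --supports 2409; the skeleton inlines the same one-line proof term so that it imports only
the Literature file): the tree event of this cycle is the Literature seat's
`FundamentalGroup.finiteEtaleCover_weakDescent` (`FundamentalGroup/FiniteEtaleQbarWeakDescent.lean`,
p125641, 2026-08-16T20:45Z) — the UNRESTRICTED weak descent of finite étale covers along `K̄ ⊂ ℂ`
(spread the cover over a smooth affine `K`-variety, specialise at a `K`-point, transport slices of
the covering map `X'(ℂ) → S₀(ℂ) × U(ℂ)` along a path in `U(ℂ)`), absorbed through v7's
`stub_connectedWeakDescentQbar_of_weakDescent` shape exactly as planned. Consequently the named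
fact C (`riemannExistence_qbarDescent_of_finiteIndex`, consumed by B) now follows from C1 ALONE
(`Theorems.linearSystemTorelli_riemannExistence_qbarDescent_of_finiteIndex_of_riemannExistence`),
and the open stubs are A, C1, D, E — sorries 4. Signatures of A, C1, D, E byte-identical to v8.

v8 (lead c9) = lead c7/c8's registered v7 (sha `e4a06b6e…`; stubs A, C1, C2', D, E with B proved, C derived)
with ONE reshape, requested by the planner of stmt-HodgeConjecture-16363 (route-choice repair
2026-08-16, "LEAD of stmt-2409: at the next reshape re-register stub D with the signature
`Theses.LinearSystemTorelli.DeligneGlobalInvariantCycles` (the item by name)"): stub D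
`stub_deligneGlobalInvariantCycles` is now stated as the ROUTE DECL
`Theses.LinearSystemTorelli.DeligneGlobalInvariantCycles` (item stmt-HodgeConjecture-16363) BY NAME,
instead of the Literature named fact `deligne_globalInvariantCycles`. The two are definitionally
equal (the route decl is the fact's body verbatim with `IsQuasiProjectiveOver S` delta-unfolded;
`stub_deligneGlobalInvariantCycles_iff` below is `Iff.rfl`), so B consumes D unchanged
(`deligneGlobalInvariantCycles_fact`), and D now closes by `exact Theses.LinearSystemTorelli.DeligneGlobalInvariantCycles_holds`
the moment the gate appends that link for stmt-16363 — exactly as the crux itself closes — while a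
discharge `deligne_globalInvariantCycles_holds` of the fact still closes it through the `Iff`.
Signatures of A, C1, C2', E are byte-identical to v7; the composition is unchanged.

History of v7 (lead c7). v7 = lead c6's registered v6 (sha `178ff6e8…`; stubs A, C1, C2, D, E with B proved, C derived) with
ONE reshape: stub C2 is WEAKENED to the form the composition actually consumes. The tree's
`FundamentalGroup.riemannExistence_qbarDescent_of_finiteIndex_of_coveringInput` (p121703) descends
only the finite étale cover that Riemann existence attaches to a CONNECTED finite topological
covering `T → S(ℂ)` (the covering of the normal core of a finite-index subgroup of `π₁`); that
cover `g : S' → S₀ ⊗_σ ℂ` has connected complex points `S'(ℂ) ≃ₜ T` and — étale over the smooth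
`S₀ ⊗_σ ℂ` — irreducible total space. So v7's
* C2' `stub_connectedWeakDescentQbar` = v6's `stub_weakDescentQbar` with the two extra hypotheses
  `IrreducibleSpace S'.left`, `ConnectedSpace (ComplexPoints S')` (strictly weaker stub: it follows
  from the unrestricted weak descent by dropping them, `stub_connectedWeakDescentQbar_of_weakDescent`,
  AND from descent of connected covers as an isomorphism of schemes, the shape of SGA1 XIII 4.6,
  `stub_connectedWeakDescentQbar_of_descent` — so a landing of either shape closes it), and
* C is now derived by the landed helper
  `Theorems.linearSystemTorelli_riemannExistence_qbarDescent_of_finiteIndex_of_riemannExistence_of_connectedWeakDescent`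
  (lead c7, `Theorems/LinearSystemTorelliMiddleDivisorSupportFourfoldStubConnectedWeakDescent.lean`,
  --supports 2409: the covering input of `…_of_coveringInput` from C1 + connected weak descent, the
  two extra hypotheses being discharged inside — `irreducibleSpace_left_of_connectedSpace_complexPoints`).
Signatures of A, B, C1, D, E byte-identical to v6. Second tree event integrated in v7: the named fact
`charlesSchnell2014_algebraicClasses_supportedOn_qbarClosed` (Charles–Schnell `ℚ̄`-supports) is
DISCHARGED (`…_holds`, `HodgeTheory/AlgebraicCyclesDefinedOverQbarProofs.lean`, p124300,
2026-08-16T20:09Z), so stub E now follows from `PeriodDeficiency.HodgeConjectureQbar` (stmt-11596)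
ALONE (`stub_qbarDivisorSupportCodimTwo_of_hodgeConjectureQbar` below lost its `hF` binder); the
kernel-checked residue of the whole line is the landed sub-goal
`Theorems.linearSystemTorelli_middleDivisorSupportFourfold_of_lineResidue` (lead c7): crux ⟸
stmt-11597 ∧ stmt-11595 ∧ stmt-11596 modulo exactly FOUR classical debts (BKU, Riemann existence
over `ℂ`, connected weak `ℚ̄`-descent, Deligne's partie fixe).

History. v6 (lead c6) = v5 with stub C1 `stub_riemannExistenceComplex` turned into the NAMED
Literature fact `FundamentalGroup.riemannExistence_finiteCovering` (Riemann's existence theorem over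
`ℂ`, covering form, SGA1 XII Thm. 5.1; `Literature/AlgebraicGeometry/FundamentalGroup/RiemannExistenceCovering.lean`,
p123138), closing by `exact riemannExistence_finiteCovering_holds` when discharged. v5 (lead c5) = v4
with stub C (the named fact `FundamentalGroup.riemannExistence_qbarDescent_of_finiteIndex`) DERIVED by
the tree's `…_of_riemannExistence_of_weakDescent` (p121703: classification of coverings via the normal
core, integrality and quasi-projectivity of the cover PROVED) from C1 (Riemann existence over `ℂ`,
covering form) and C2 (weak descent of finite étale covers along `ℚ̄ ⊂ ℂ` up to homeomorphism over
`S(ℂ)`, the consumed part of SGA1 XIII Prop. 4.6, being discharged in the tree by spreading out +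
specialisation: `Topology/CoveringSpaces/CoveringSliceTransport`, `CoveringFamilyMonodromy` p121328,
`Motives/ComplexPointsFiniteEtaleCovering`, `Limits/FiniteTypeModelDescent` p121917,
`Limits/LocalizationEtaleSpread` p123261, `Limits/LocalizationFiniteSpread` p123572).
The signatures of A, B, D, E are byte-identical to v3/v4.

Status after cycle 11 (lead c11, 2026-08-16T23:0xZ; unchanged stub-wise since cycle 10). Stubs and what each open one is blocked on:
* A' `stub_typeStabilityAtQbarGeneric` — OPEN transcendence kernel (registered stub since v10); ⟸ stmt-11595 ∧
  stmt-11597 ∧ Deligne–André type stability at Hodge-generic points (certificate below); ⟸ HC(4,2).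
* A `stub_finiteMonodromyAtGenericSpread` — DERIVED from A' since v10, unconditionally (p127337); v3–v9: ⟸ stmt-11595 ∧
  stmt-11597 modulo `bku_finite_monodromyOrbit_of_isHodgeGenericIn` (landed reduction p119481).
* C1 `stub_riemannExistenceComplex` — the named fact `FundamentalGroup.riemannExistence_finiteCovering`
  (Riemann existence over `ℂ`, covering form; p123138), undischarged named-fact debt (GAGA-sized;
  Literature seat active on SGA1 XII 5.1: `RiemannExistenceCoveringProofs`, `RiemannExistenceFullyFaithful*`).
  Since cycle 9 it is the line's ONLY covering debt: C ⟸ C1 by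
  `Theorems.linearSystemTorelli_riemannExistence_qbarDescent_of_finiteIndex_of_riemannExistence` (p126502)
  and equally by the tree's `FundamentalGroup.riemannExistence_qbarDescent_of_finiteIndex_of_riemannExistence_finiteCovering`
  (p126127).
* C2' `stub_connectedWeakDescentQbar` — PROVED and LANDED (cycle 9, p126502,
  `Theorems.stub_connectedWeakDescentQbar`, from the tree's `FundamentalGroup.finiteEtaleCover_weakDescent` p125641).
* D `stub_deligneGlobalInvariantCycles` — the route crux stmt-HodgeConjecture-16363
  (`LinearSystemTorelli.DeligneGlobalInvariantCycles`) BY NAME since v8 (Iff.rfl with the named fact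
  `deligne_globalInvariantCycles`); its Leray half `deligne1968_invariantClass_fromTotalSpace` is
  DISCHARGED (`…_holds`), so the residue is exactly a Deligne mixed-Hodge-structure package satisfying
  Hodge II Cor. 3.2.17 (`stub_deligneGlobalInvariantCycles_of_mixedHodge` below, sorry-free).
* E `stub_qbarDivisorSupportCodimTwo` — OPEN for `m ≥ 4` only: the case `m ≤ 3` is PROVED and landed
  (p121589, `Theorems.linearSystemTorelli_stub_qbarDivisorSupportCodimTwo_of_le_three`, Andreotti–Frankel;
  `stub_qbarDivisorSupportCodimTwo_of_le_three` below); for `m ≥ 4` it is HC over `ℚ̄` in codimension 2 in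
  support form, ⟸ stmt-11596 ALONE since the Charles–Schnell fact was discharged (p117963 + p124300).
The kernel-checked residue of the line is now `Theorems.linearSystemTorelli_middleDivisorSupportFourfold_of_lineResidue_of_weakDescent`
(p126502): crux ⟸ stmt-11597 ∧ stmt-11595 ∧ stmt-11596 modulo exactly THREE classical debts (BKU,
Riemann existence over `ℂ`, Deligne's partie fixe = stmt-16363).
Since cycle 10: `Theorems.linearSystemTorelli_middleDivisorSupportFourfold_of_lineResidue_of_typeStability`
(lead c10): crux ⟸ A' ∧ stmt-11596 modulo exactly TWO classical debts (Riemann existence over `ℂ`,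
Deligne's partie fixe = stmt-16363).

Composition (kernel-checked, `MiddleDivisorSupportFourfold_of`), for one fixed `σ : ℚ̄ →+* ℂ`:

  stub_typeStabilityAtQbarGeneric       (A', TRANSFER kernel — OPEN, registered since v10: loop-continuations
                                         of rational `(2,2)`-classes at `ℚ̄`-generic points of `ℚ̄`-families of
                                         fourfolds are `(2,2)`; gives A unconditionally, p127337)
  stub_finiteMonodromyAtGenericSpread   (A, derived from A' since v10 — every rational `(2,2)`-class on a
                                         complex fourfold `X` has, on SOME `ℚ̄`-spread `X ≅ 𝒳_s` with `s`
                                         over the generic point of the smooth irreducible `ℚ̄`-base,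
                                         a FINITE monodromy orbit; ⟸ PeriodDeficiency.QbarGenericIsHodgeGeneric
                                         (stmt-11595) ∧ ClassicalGeometricVHS (stmt-11597) modulo the named
                                         facts `spreadingOut_smoothProjective_qbarFamily`,
                                         `bku_finite_monodromyOrbit_of_isHodgeGenericIn`)
  stub_dominantEnvelopeOfFiniteMonodromy (B, TRANSFER mechanism — PROVED and LANDED, p119525
                                         `Theorems/…StubDominantEnvelope.lean`: Voisin 2007 §3 / Charles–Schnell
                                         Thm 11.3.19 with DOMINANCE: a finite-monodromy class at a
                                         `ℚ̄`-generic point is the pull-back of a rational `(p,p)` class on a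
                                         smooth projective `ℚ̄`-variety along a `ℂ`-morphism DOMINANT onto
                                         the `ℚ̄`-model; antecedents = the two named facts C, D)
  stub_riemannExistenceQbarDescent       (C = named fact `FundamentalGroup.riemannExistence_qbarDescent_of_finiteIndex`,
                                         DERIVED since v15 from C1' `stub_algebraicSeparatingSmoothAffine`
                                         (algebraic separating functions on finite coverings of smooth
                                         irreducible affine `ℂ`-schemes) by the tree's
                                         `…_of_algebraicSeparating`; v6–v14 from C1 = named fact
                                         `FundamentalGroup.riemannExistence_finiteCovering` (+ C2', lead c7))
  stub_deligneGlobalInvariantCycles      (D = named fact `deligne_globalInvariantCycles`)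
  stub_qbarDivisorSupportCodimTwo        (E, SECTOR — OPEN: rational `(2,2)`-classes on smooth projective
                                         `W₀ ⊗_σ ℂ` die off `π⁻¹ Z₀`, `Z₀ ⊊ W₀` proper `ℚ̄`-closed;
                                         ⟸ PeriodDeficiency.HodgeConjectureQbar (stmt-11596) alone — the
                                         Charles–Schnell `ℚ̄`-support fact it also needs is DISCHARGED,
                                         `charlesSchnell2014_algebraicClasses_supportedOn_qbarClosed_holds`)
  ⟹ crux, by `linearSystemTorelli_middleDivisorSupportFourfold_of_dominantQbarEnvelope` (p117963: the
  glue — pull-back of the complement of `π⁻¹ Z₀` along the dominant map is a proper closed subset of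
  the integral fourfold — is PROVED; no Fulton / cycle class).

All stubs are stated over existing declarations only (no new vocabulary).
-/

-- every declaration of this problem lives in `Summit.HodgeConjecture.HodgeConjecture.…`
set_option linter.dupNamespace false

namespace Summit.HodgeConjecture.HodgeConjecture.Cruxes.MiddleDivisorSupportFourfold.WeaklyNonFactorDescent

open CategoryTheory AlgebraicGeometry Topology
open Literature.AlgebraicGeometry Literature.AlgebraicGeometry.Motives
open Literature.AlgebraicGeometry.HodgeTheory
open Literature.AlgebraicTopology.SingularHomology

/-! ### The registered stubs (A'', C1''', D, E open; A' derived from A'', A from A'; C1'' derived from C1''', C1' from C1''; B, C2' proved; C derived from C1') -/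

/-- **A'' (TRANSFER kernel, OPEN; registered stub since v16): type stability at `ℚ̄`-generic points,
Zariski-locally on the base.** For `σ : ℚ̄ →+* ℂ`, a `ℚ̄`-morphism `f₀ : 𝒳₀ ⟶ S₀` of quasi-projective
`ℚ̄`-schemes with `S₀` smooth irreducible whose complexification is a smooth projective family of
relative dimension `4`, a complex point `s` over the GENERIC point of `S₀` and a rational `(2,2)`-class
`α` on `𝒳_s`: there is a proper Zariski-closed `Z₀ ⊊ S₀` such that every flat continuation `β` of `α`
along a loop at `s` all of whose points lie over `S₀ ∖ Z₀` is again of type `(2,2)`. Equivalent to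
v10–v15's A' (`⟸`: `Z₀ = ∅`; `⟹`: loops at a `ℚ̄`-generic point may be moved into any dense
`ℚ̄`-Zariski open without changing the continuation, p136872) but formally WEAKER as a statement to
prove: any proper closed part of the base may be discarded first. OPEN (Voisin 2007's question on the
field of definition of Hodge loci); implied by HC(4,2); implies A' and A below unconditionally. -/
theorem stub_typeStabilityAtQbarGenericZariskiLocal :
    ∀ (σ : AlgebraicClosure ℚ →+* ℂ) ⦃𝒳₀ S₀ : SchemeOver (AlgebraicClosure ℚ)⦄ (f₀ : 𝒳₀ ⟶ S₀),
      IsQuasiProjectiveOver 𝒳₀ → IsQuasiProjectiveOver S₀ → IrreducibleSpace S₀.left →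
      AlgebraicGeometry.Smooth S₀.hom → IsSmoothProjectiveFamily ((baseChangeHom σ).map f₀) 4 →
      ∀ (s : ComplexPoints ((baseChangeHom σ).obj S₀)),
        closure {(baseChangeHomFst σ S₀).base s.pt} = (Set.univ : Set S₀.left) →
        ∀ (α : complexBetti (fiberOver ((baseChangeHom σ).map f₀) s) 4),
          IsRationalClass α → IsOfHodgeType 4 (fiberOver ((baseChangeHom σ).map f₀) s) 4 2 2 α →
          ∃ Z₀ : Set S₀.left, IsClosed Z₀ ∧ Z₀ ≠ Set.univ ∧
            ∀ (γ : Path s s), (∀ u, (baseChangeHomFst σ S₀).base (γ u).pt ∉ Z₀) →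
              ∀ (β : complexBetti (fiberOver ((baseChangeHom σ).map f₀) s) 4),
                IsContinuationAlong γ α β →
                  IsOfHodgeType 4 (fiberOver ((baseChangeHom σ).map f₀) s) 4 2 2 β := by
  sorry

/-- **A' (v10–v15's registered kernel) — DERIVED from A'' since v16, UNCONDITIONALLY** (p136872
`IsContinuationAlong.exists_loop_forall_base_pt_notMem_of_qbarFamily`: a continuation along some loop
at the `ℚ̄`-generic `s` is a continuation along a loop over `S₀ ∖ Z₀`). Type stability at `ℚ̄`-generic
points: every flat continuation `β` of a rational `(2,2)`-class `α` along a loop at a point `s` over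
the generic point of the smooth irreducible `ℚ̄`-base is of type `(2,2)`. Name and signature unchanged
(consumed by `stub_finiteMonodromyAtGenericSpread`). -/
theorem stub_typeStabilityAtQbarGeneric :
    ∀ (σ : AlgebraicClosure ℚ →+* ℂ) ⦃𝒳₀ S₀ : SchemeOver (AlgebraicClosure ℚ)⦄ (f₀ : 𝒳₀ ⟶ S₀),
      IsQuasiProjectiveOver 𝒳₀ → IsQuasiProjectiveOver S₀ → IrreducibleSpace S₀.left →
      AlgebraicGeometry.Smooth S₀.hom → IsSmoothProjectiveFamily ((baseChangeHom σ).map f₀) 4 →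
      ∀ (s : ComplexPoints ((baseChangeHom σ).obj S₀)),
        closure {(baseChangeHomFst σ S₀).base s.pt} = (Set.univ : Set S₀.left) →
        ∀ (α : complexBetti (fiberOver ((baseChangeHom σ).map f₀) s) 4),
          IsRationalClass α → IsOfHodgeType 4 (fiberOver ((baseChangeHom σ).map f₀) s) 4 2 2 α →
          ∀ (γ : Path s s) (β : complexBetti (fiberOver ((baseChangeHom σ).map f₀) s) 4),
            IsContinuationAlong γ α β →
              IsOfHodgeType 4 (fiberOver ((baseChangeHom σ).map f₀) s) 4 2 2 β := by
  intro σ 𝒳₀ S₀ f₀ h𝒳₀ hS₀ hirr hsm hf s hgen α hα hh γ β hγ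
  obtain ⟨Z₀, hZ₀, hZ₀', H⟩ :=
    stub_typeStabilityAtQbarGenericZariskiLocal σ f₀ h𝒳₀ hS₀ hirr hsm hf s hgen α hα hh
  haveI := hirr
  haveI := hsm
  obtain ⟨γ', hγ', hc⟩ :=
    IsContinuationAlong.exists_loop_forall_base_pt_notMem_of_qbarFamily σ f₀ 4 hS₀ hf hZ₀ hZ₀'
      hgen hγ
  exact H γ' hγ' β hc

/-- **A'' ⟸ A'** (the reshape v15 → v16 is a weakening): with `Z₀ = ∅` the Zariski-local statement is
the global one. -/
theorem stub_typeStabilityAtQbarGenericZariskiLocal_of_typeStability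
    (hT : ∀ (σ : AlgebraicClosure ℚ →+* ℂ) ⦃𝒳₀ S₀ : SchemeOver (AlgebraicClosure ℚ)⦄ (f₀ : 𝒳₀ ⟶ S₀),
        IsQuasiProjectiveOver 𝒳₀ → IsQuasiProjectiveOver S₀ → IrreducibleSpace S₀.left →
        AlgebraicGeometry.Smooth S₀.hom → IsSmoothProjectiveFamily ((baseChangeHom σ).map f₀) 4 →
        ∀ (s : ComplexPoints ((baseChangeHom σ).obj S₀)),
          closure {(baseChangeHomFst σ S₀).base s.pt} = (Set.univ : Set S₀.left) →
          ∀ (α : complexBetti (fiberOver ((baseChangeHom σ).map f₀) s) 4),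
            IsRationalClass α → IsOfHodgeType 4 (fiberOver ((baseChangeHom σ).map f₀) s) 4 2 2 α →
            ∀ (γ : Path s s) (β : complexBetti (fiberOver ((baseChangeHom σ).map f₀) s) 4),
              IsContinuationAlong γ α β →
                IsOfHodgeType 4 (fiberOver ((baseChangeHom σ).map f₀) s) 4 2 2 β) :
    ∀ (σ : AlgebraicClosure ℚ →+* ℂ) ⦃𝒳₀ S₀ : SchemeOver (AlgebraicClosure ℚ)⦄ (f₀ : 𝒳₀ ⟶ S₀),
      IsQuasiProjectiveOver 𝒳₀ → IsQuasiProjectiveOver S₀ → IrreducibleSpace S₀.left →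
      AlgebraicGeometry.Smooth S₀.hom → IsSmoothProjectiveFamily ((baseChangeHom σ).map f₀) 4 →
      ∀ (s : ComplexPoints ((baseChangeHom σ).obj S₀)),
        closure {(baseChangeHomFst σ S₀).base s.pt} = (Set.univ : Set S₀.left) →
        ∀ (α : complexBetti (fiberOver ((baseChangeHom σ).map f₀) s) 4),
          IsRationalClass α → IsOfHodgeType 4 (fiberOver ((baseChangeHom σ).map f₀) s) 4 2 2 α →
          ∃ Z₀ : Set S₀.left, IsClosed Z₀ ∧ Z₀ ≠ Set.univ ∧
            ∀ (γ : Path s s), (∀ u, (baseChangeHomFst σ S₀).base (γ u).pt ∉ Z₀) →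
              ∀ (β : complexBetti (fiberOver ((baseChangeHom σ).map f₀) s) 4),
                IsContinuationAlong γ α β →
                  IsOfHodgeType 4 (fiberOver ((baseChangeHom σ).map f₀) s) 4 2 2 β := by
  intro σ 𝒳₀ S₀ f₀ h𝒳₀ hS₀ hirr hsm hf s hgen α hα hh
  haveI := hirr
  refine ⟨∅, isClosed_empty, ?_, fun γ _ β hγ ↦ hT σ f₀ h𝒳₀ hS₀ hirr hsm hf s hgen α hα hh γ β hγ⟩
  obtain ⟨z⟩ := (inferInstance : Nonempty S₀.left)
  exact fun h ↦ (h.symm ▸ Set.mem_univ z : z ∈ (∅ : Set S₀.left))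

/-- **A type-stable rational class has finite monodromy orbit — UNCONDITIONAL** (the general
`(n,p)` lemma of p127337, `Theorems.linearSystemTorelli_finite_setOf_isContinuationAlong_of_forall_isOfHodgeType`,
inlined so that the skeleton imports only Literature files): in the complexification of a smooth
projective family of quasi-projective `ℚ̄`-varieties over a smooth irreducible base, a rational class
`α ∈ H²ᵖ(𝒳_s)` all of whose continuations along loops at `s` are of type `(p,p)` has finitely many
such continuations — Hodge–Riemann for the relative hyperplane class (`hodgeRiemann_polarizationForm_qbarFamily`,
PROVED), polarization invariance (`polarizationForm_transportFun_self`), lattice finiteness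
(`finite_setOf_isContinuationAlong_of_norm_eq_baseChangeHom`), continuations = transports
(`setOf_isContinuationAlong_eq_range_transportFun`). -/
theorem finite_setOf_isContinuationAlong_of_forall_isOfHodgeType
    (σ : AlgebraicClosure ℚ →+* ℂ) ⦃𝒳₀ S₀ : SchemeOver (AlgebraicClosure ℚ)⦄ (f₀ : 𝒳₀ ⟶ S₀)
    (n p : ℕ) (hf : IsSmoothProjectiveFamily ((baseChangeHom σ).map f₀) n)
    (h𝒳₀ : IsQuasiProjectiveOver 𝒳₀) (hS₀ : IsQuasiProjectiveOver S₀)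
    (hirr : IrreducibleSpace S₀.left) (hsm : AlgebraicGeometry.Smooth S₀.hom)
    (s : ComplexPoints ((baseChangeHom σ).obj S₀))
    (α : complexBetti (fiberOver ((baseChangeHom σ).map f₀) s) (2 * p)) (hα : IsRationalClass α)
    (hT : ∀ (γ : Path s s) (β : complexBetti (fiberOver ((baseChangeHom σ).map f₀) s) (2 * p)),
      IsContinuationAlong γ α β →
        IsOfHodgeType n (fiberOver ((baseChangeHom σ).map f₀) s) (2 * p) p p β) :
    {β : complexBetti (fiberOver ((baseChangeHom σ).map f₀) s) (2 * p) |
        ∃ γ : Path s s, IsContinuationAlong γ α β}.Finite := by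
  haveI := hirr
  haveI := hsm
  have hXs : IsSmoothProjective n (fiberOver ((baseChangeHom σ).map f₀) s) :=
    hf.isSmoothProjective s
  obtain ⟨A, -⟩ := hT (Path.refl s) α (IsContinuationAlong.refl α)
  obtain ⟨K, hL, τ, hQrat, hQpos⟩ :=
    hodgeRiemann_polarizationForm_qbarFamily σ f₀ n p hf h𝒳₀ hS₀ hirr hsm s
  refine finite_setOf_isContinuationAlong_of_norm_eq_baseChangeHom (2 * p) σ f₀ hf hS₀ s
    (fun x ↦ IsOfHodgeType n (fiberOver ((baseChangeHom σ).map f₀) s) (2 * p) p p x)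
    (IsOfHodgeType.zero A (2 * p) p p) (fun x y hx hy ↦ hx.add hXs hy)
    (fun c x hx ↦ hx.smul (c : ℂ)) _ hQrat hQpos α hα (fun γ ↦ ?_) (fun γ ↦ ?_)
  · have hmem : (transportFun ((baseChangeHom σ).map f₀) (2 * p)
        (isCohomologicallyLocallyTrivialOn_univ_baseChangeHom σ f₀ hf hS₀) γ α :) ∈
        {β : complexBetti (fiberOver ((baseChangeHom σ).map f₀) s) (2 * p) |
          ∃ γ : Path s s, IsContinuationAlong γ α β} := by
      rw [setOf_isContinuationAlong_eq_range_transportFun ((baseChangeHom σ).map f₀) (2 * p)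
        (isCohomologicallyLocallyTrivialOn_univ_baseChangeHom σ f₀ hf hS₀) s α]
      exact ⟨γ, rfl⟩
    obtain ⟨γ', hγ'⟩ := hmem
    exact hT γ' _ hγ'
  · exact polarizationForm_transportFun_self ((baseChangeHom σ).map f₀)
      (isCohomologicallyLocallyTrivialOn_univ_baseChangeHom σ f₀ hf hS₀) K (s := ⟨s, Set.mem_univ s⟩)
      hXs hL τ γ α

/-- **A (finite monodromy at the `ℚ̄`-generic spread point) — DERIVED from A' since v10,
UNCONDITIONALLY** (`Theorems.stub_finiteMonodromyAtGenericSpread_of_typeStabilityAtQbarGeneric`,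
p127337: spreading out PROVED, Hodge–Riemann for the relative hyperplane class PROVED, lattice
finiteness + polarization invariance + continuation/transport bridge).  For `σ : ℚ̄ →+* ℂ` and a
rational `(2,2)`-class `c` on a smooth projective complex fourfold `X`: there is a `ℚ̄`-spread of `X`
— a `ℚ̄`-morphism `f₀ : 𝒳₀ ⟶ S₀` of quasi-projective `ℚ̄`-schemes, `S₀` smooth irreducible, with
smooth projective complexification of relative dimension `4`, a complex point `s` over the generic
point of `S₀` and `e : X ≅ 𝒳_s` — on which the transported class `(e⁻¹)^* c` has FINITE monodromy
orbit.  (v3–v9: a registered stub, known from stmt-11597 ∧ stmt-11595 modulo the BKU named fact,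
p119481; name and signature unchanged, still consumed by `dominantQbarEnvelopeFourfoldCodimTwo`.) -/
theorem stub_finiteMonodromyAtGenericSpread :
    ∀ (σ : AlgebraicClosure ℚ →+* ℂ) ⦃X : SchemeOver ℂ⦄, IsSmoothProjective 4 X →
      ∀ (c : complexBetti X 4), IsRationalClass c → IsOfHodgeType 4 X 4 2 2 c →
        ∃ (𝒳₀ S₀ : SchemeOver (AlgebraicClosure ℚ)) (f₀ : 𝒳₀ ⟶ S₀)
          (s : ComplexPoints ((baseChangeHom σ).obj S₀))
          (e : X ≅ fiberOver ((baseChangeHom σ).map f₀) s),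
          IsQuasiProjectiveOver 𝒳₀ ∧ IsQuasiProjectiveOver S₀ ∧ IrreducibleSpace S₀.left ∧
          AlgebraicGeometry.Smooth S₀.hom ∧
          IsSmoothProjectiveFamily ((baseChangeHom σ).map f₀) 4 ∧
          closure {(baseChangeHomFst σ S₀).base s.pt} = (Set.univ : Set S₀.left) ∧
          {β : complexBetti (fiberOver ((baseChangeHom σ).map f₀) s) 4 |
              ∃ γ : Path s s, IsContinuationAlong γ (complexBetti.map e.inv 4 c) β}.Finite := by
  -- = `Theorems.stub_finiteMonodromyAtGenericSpread_of_typeStabilityAtQbarGeneric stub_typeStabilityAtQbarGeneric` (p127337)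
  intro σ X hX c hc hh
  obtain ⟨𝒳₀, S₀, f₀, s, h𝒳₀, hS₀, hirr, hsm, hf, hgen, ⟨e⟩⟩ :=
    spreadingOut_smoothProjective_qbarFamily_holds σ hX
  refine ⟨𝒳₀, S₀, f₀, s, e, h𝒳₀, hS₀, hirr, hsm, hf, hgen, ?_⟩
  exact finite_setOf_isContinuationAlong_of_forall_isOfHodgeType σ f₀ 4 2 hf h𝒳₀ hS₀ hirr hsm s
    (complexBetti.map e.inv 4 c) (hc.map _)
    (stub_typeStabilityAtQbarGeneric σ f₀ h𝒳₀ hS₀ hirr hsm hf s hgen (complexBetti.map e.inv 4 c)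
      (hc.map _) (hh.map_of_iso e.symm))

/-- **B (TRANSFER mechanism — PROVED, landed p119525 as
`Theorems.stub_dominantEnvelopeOfFiniteMonodromy`; Voisin 2007 §3, proof of Prop. 0.7; Charles–Schnell
Thm 11.3.19; with DOMINANCE).** Granted Riemann's existence theorem with `ℚ̄`-descent of finite étale covers (C)
and Deligne's global invariant cycle theorem (D): for a `ℚ̄`-family `f₀ : 𝒳₀ ⟶ S₀` as in A, a complex
point `s` over the GENERIC point of `S₀` and a rational `(p,p)` class `α` on `𝒳_s` with finite
monodromy orbit, there are a `ℚ̄`-scheme `W₀` with smooth projective complexification of some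
dimension `m`, a `ℂ`-morphism `ι : 𝒳_s ⟶ W₀ ⊗_σ ℂ` whose composite with the projection to `W₀` has
DENSE image, and a rational `(p,p)` class `c'` on `W₀ ⊗_σ ℂ` with `ι^* c' = α`. (`W₀` = Hironaka
compactification over `ℚ̄` of `𝒳₀ ×_{S₀} S₀'`, `S₀' → S₀` the finite étale cover killing the monodromy
of `α`; `c'` = the Hodge lift of the invariant section; dominance because `𝒳_s` maps onto the generic
fibre of `𝒳₀ ×_{S₀} S₀' → S₀'`.) -/
theorem stub_dominantEnvelopeOfFiniteMonodromy :
    Literature.AlgebraicGeometry.FundamentalGroup.riemannExistence_qbarDescent_of_finiteIndex →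
    deligne_globalInvariantCycles →
    ∀ (σ : AlgebraicClosure ℚ →+* ℂ) ⦃𝒳₀ S₀ : SchemeOver (AlgebraicClosure ℚ)⦄ (f₀ : 𝒳₀ ⟶ S₀)
      (n p : ℕ), IsQuasiProjectiveOver 𝒳₀ → IsQuasiProjectiveOver S₀ → IrreducibleSpace S₀.left →
      AlgebraicGeometry.Smooth S₀.hom → IsSmoothProjectiveFamily ((baseChangeHom σ).map f₀) n →
      ∀ (s : ComplexPoints ((baseChangeHom σ).obj S₀)),
        closure {(baseChangeHomFst σ S₀).base s.pt} = (Set.univ : Set S₀.left) →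
        ∀ (α : complexBetti (fiberOver ((baseChangeHom σ).map f₀) s) (2 * p)),
          IsRationalClass α → IsOfHodgeType n (fiberOver ((baseChangeHom σ).map f₀) s) (2 * p) p p α →
          {β : complexBetti (fiberOver ((baseChangeHom σ).map f₀) s) (2 * p) |
              ∃ γ : Path s s, IsContinuationAlong γ α β}.Finite →
          ∃ (m : ℕ) (W₀ : SchemeOver (AlgebraicClosure ℚ))
            (ι : fiberOver ((baseChangeHom σ).map f₀) s ⟶ (baseChangeHom σ).obj W₀)
            (c' : complexBetti ((baseChangeHom σ).obj W₀) (2 * p)),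
            IsSmoothProjective m ((baseChangeHom σ).obj W₀) ∧
            DenseRange (ι.left ≫ baseChangeHomFst σ W₀).base ∧
            IsRationalClass c' ∧ IsOfHodgeType m ((baseChangeHom σ).obj W₀) (2 * p) p p c' ∧
            complexBetti.map ι (2 * p) c' = α :=
  Theorems.stub_dominantEnvelopeOfFiniteMonodromy

/-- **C1''' (registered stub since v18; the ZARISKI-LOCAL smooth-affine separating-function residual
of Riemann's existence theorem IN RELATIVE DIMENSION `≥ 2`).** For every smooth irreducible AFFINE
`ℂ`-scheme `S` of relative dimension `n + 2`, every covering map `q : T → S(ℂ)` with finite fibres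
and every `P₀ ∈ S(ℂ)`, there are an affine open `U ∋ P₀` of `S`, a function `h : T → ℂ` continuous
on `q⁻¹(U(ℂ))` and injective on `q⁻¹(P₀)`, and a NON-ZERO `F ∈ Γ(S, U)[τ]` with `F(q t)(h t) = 0`
whenever `q t ∈ U(ℂ)` — verbatim (per `S`, restricted to relative dimension `≥ 2`) the hypothesis of
the tree's `FundamentalGroup.riemannExistence_qbarDescent_of_finiteIndex_of_locallyAlgebraicSeparating`
(`RiemannExistenceQbarDescentProofs`, 2026-08-17T02:27Z: "the shape produced by weighted `L²`
estimates in étale coordinates on an affine neighbourhood of `P₀`", the Riemann-existence seat's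
last hook before releasing the fact with "dimension `≥ 2`: theories absent"). It is v17's C1''
(global `h`, `F` over `Γ(S, 𝒪_S)`) made LOCAL on the base: C1''' ⟸ C1'' with `U = ⊤`
(`stub_locallyAlgebraicSeparatingSmoothAffineDimGeTwo_of_algebraicSeparating`, sorry-free), and
C1'' is DERIVED from C1''' below (Theorem B′ on `U` + Theorem A + Chinese remainders on the
algebraised cover), so the reshape loses nothing. Relative dimension `≤ 1` is PROVED in the tree
(`FundamentalGroup.algebraicSeparating_of_smoothOfRelativeDimension_le_one`). What remains is the
function-theoretic heart of SGA 1 XII 5.1 on complex-manifold coverings of smooth affine varieties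
of dimension `≥ 2`, now in its local form: near each point, a holomorphic function on the covering,
algebraic over the regular functions of an affine neighbourhood, separating one fibre
(Grauert–Remmert on an snc compactification / GAGA / Hörmander `L²` in étale coordinates).
[cite: SGA1, Exp. XII Thm. 5.1 (p. 333), proof, part 2] -/
theorem stub_locallyAlgebraicSeparatingSmoothAffineDimGeTwo :
    ∀ (n : ℕ) (S : SchemeOver ℂ), IsAffine S.left → SmoothOfRelativeDimension (n + 2) S.hom →
      IrreducibleSpace S.left →
      ∀ (T : Type) [TopologicalSpace T] (q : T → ComplexPoints S) (_ : IsCoveringMap q)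
        (_ : ∀ t, (q ⁻¹' {t}).Finite) (P₀ : ComplexPoints S),
        ∃ (U : S.left.Opens) (_ : IsAffineOpen U) (_ : P₀.pt ∈ U) (h : T → ℂ)
          (F : Polynomial Γ(S.left, U)),
          ContinuousOn h (q ⁻¹' {P | P.pt ∈ U}) ∧ F ≠ 0 ∧
          (∀ (t : T) (ht : (q t).pt ∈ U), (F.map ((q t).evalRingHom U ht)).eval (h t) = 0) ∧
          Set.InjOn h (q ⁻¹' {P₀}) := by
  sorry

/-- **C1''' ⟸ C1''** (the reshape v17 → v18 is a weakening): a GLOBAL algebraic separating function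
(`h` continuous on `T`, `F ≠ 0` over `Γ(S, 𝒪_S)`) is a local one on the affine open `U = ⊤`
(evaluation at `q t` through `⊤` is literally the same ring map). -/
theorem stub_locallyAlgebraicSeparatingSmoothAffineDimGeTwo_of_algebraicSeparating
    (H : ∀ (n : ℕ) (S : SchemeOver ℂ), IsAffine S.left → SmoothOfRelativeDimension (n + 2) S.hom →
      IrreducibleSpace S.left →
      ∀ (T : Type) [TopologicalSpace T] (q : T → ComplexPoints S) (_ : IsCoveringMap q)
        (_ : ∀ t, (q ⁻¹' {t}).Finite) (P₀ : ComplexPoints S),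
        ∃ (h : T → ℂ) (F : Polynomial Γ(S.left, ⊤)), Continuous h ∧ F ≠ 0 ∧
          (∀ t, (F.map ((q t).evalRingHom ⊤ trivial)).eval (h t) = 0) ∧
          Set.InjOn h (q ⁻¹' {P₀})) :
    ∀ (n : ℕ) (S : SchemeOver ℂ), IsAffine S.left → SmoothOfRelativeDimension (n + 2) S.hom →
      IrreducibleSpace S.left →
      ∀ (T : Type) [TopologicalSpace T] (q : T → ComplexPoints S) (_ : IsCoveringMap q)
        (_ : ∀ t, (q ⁻¹' {t}).Finite) (P₀ : ComplexPoints S),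
        ∃ (U : S.left.Opens) (_ : IsAffineOpen U) (_ : P₀.pt ∈ U) (h : T → ℂ)
          (F : Polynomial Γ(S.left, U)),
          ContinuousOn h (q ⁻¹' {P | P.pt ∈ U}) ∧ F ≠ 0 ∧
          (∀ (t : T) (ht : (q t).pt ∈ U), (F.map ((q t).evalRingHom U ht)).eval (h t) = 0) ∧
          Set.InjOn h (q ⁻¹' {P₀}) :=
  fun n S hS hn hirr T _ q hq hfin P₀ ↦ by
    haveI := hS
    obtain ⟨h, F, hh, hF, hroot, hinj⟩ := H n S hS hn hirr T q hq hfin P₀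
    exact ⟨⊤, isAffineOpen_top S.left, trivial, h, F, hh.continuousOn, hF,
      fun t _ ↦ hroot t, hinj⟩

/-- **C1'' (v17's registered stub) — DERIVED from C1''' since v18.** For every smooth irreducible
AFFINE `ℂ`-scheme `S` of relative dimension `n + 2`, every covering map `q : T → S(ℂ)` with finite
fibres and every `P₀ ∈ S(ℂ)`, there is a continuous `h : T → ℂ`, injective on `q⁻¹(P₀)` and
ALGEBRAIC over `Γ(S, 𝒪_S)` along `q` (`F(q t)(h t) = 0` for one non-zero `F ∈ Γ(S, 𝒪_S)[τ]`).
Proof from C1''' for the SAME `S`: at every point the local algebraic separating function of C1'''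
has a monic regular characteristic polynomial over its affine neighbourhood (Theorem B′,
`ContinuousRational.exists_charPoly_of_algebraic`; the local rings of the smooth `S` are regular),
so Theorem A (`CharPoly.exists_finite_etale_homeomorph_of_charPoly_of_isCoveringMap`: standard
étale algebras glued Zariski-locally) algebraises `q` as `S'(ℂ) → S(ℂ)` for a finite étale
`S' → S`, and on an algebraised cover global INTEGRAL separating functions exist
(`integralSeparating_of_isFinite`: Chinese remainder theorem in `Γ(S', 𝒪)`); a monic equation is
non-zero on the integral `S`. Name and signature unchanged (v17); relative dimension `≤ 1` is the
tree's `FundamentalGroup.algebraicSeparating_of_smoothOfRelativeDimension_le_one`, and C1' below is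
derived from the two as before. [cite: SGA1, Exp. XII Thm. 5.1 (p. 333), proof, part 2] -/
theorem stub_algebraicSeparatingSmoothAffineDimGeTwo :
    ∀ (n : ℕ) (S : SchemeOver ℂ), IsAffine S.left → SmoothOfRelativeDimension (n + 2) S.hom →
      IrreducibleSpace S.left →
      ∀ (T : Type) [TopologicalSpace T] (q : T → ComplexPoints S) (_ : IsCoveringMap q)
        (_ : ∀ t, (q ⁻¹' {t}).Finite) (P₀ : ComplexPoints S),
        ∃ (h : T → ℂ) (F : Polynomial Γ(S.left, ⊤)), Continuous h ∧ F ≠ 0 ∧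
          (∀ t, (F.map ((q t).evalRingHom ⊤ trivial)).eval (h t) = 0) ∧
          Set.InjOn h (q ⁻¹' {P₀}) := by
  intro n S hS hn hirr T _ q hq hfin P₀
  haveI := hS; haveI := hn; haveI := hirr
  haveI : AlgebraicGeometry.Smooth S.hom := SmoothOfRelativeDimension.smooth (n + 2) S.hom
  haveI : IsSeparated S.hom := inferInstance
  haveI : LocallyOfFiniteType S.hom := inferInstance
  -- `S` is integral with regular local rings: smooth over `ℂ` and irreducible
  have hSreg : Literature.AlgebraicGeometry.Resolution.Scheme.IsRegular S.left :=
    Literature.AlgebraicGeometry.Resolution.Scheme.IsRegular.of_smooth S.hom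
      (Literature.AlgebraicGeometry.Resolution.Scheme.isRegular_Spec (CommRingCat.of ℂ))
  haveI : IsReduced S.left := hSreg.isReduced
  haveI : IsIntegral S.left := isIntegral_of_irreducibleSpace_of_isReduced _
  -- Theorem A fed, point by point, with C1''' made monic-regular by Theorem B′ on `U`
  obtain ⟨S', g, Φ, hgfin, -, hcomm⟩ :=
    Literature.AlgebraicGeometry.FundamentalGroup.CharPoly.exists_finite_etale_homeomorph_of_charPoly_of_isCoveringMap
      q hq hfin fun P ↦ by
        obtain ⟨U, hU, hPU, h, F, hh, hF, hroot, hinj⟩ :=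
          stub_locallyAlgebraicSeparatingSmoothAffineDimGeTwo n S hS hn hirr T q hq hfin P
        obtain ⟨Q, hQ, hroots⟩ :=
          Literature.AlgebraicGeometry.FundamentalGroup.ContinuousRational.exists_charPoly_of_algebraic
            (X := S) hSreg hU hq hfin h hh F hF hroot
        exact ⟨U, hU, hPU, h, Q, hh, hQ, hroots, hinj⟩
  haveI := hgfin
  -- integral (hence algebraic: monic ⟹ non-zero on the integral `S`) separating functions on the
  -- algebraised cover
  obtain ⟨h, R, hh, hR, hroot, hinj⟩ :=
    Literature.AlgebraicGeometry.FundamentalGroup.integralSeparating_of_isFinite S q hfin P₀ g Φ hcomm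
  exact ⟨h, R, hh, hR.ne_zero, hroot, hinj⟩

/-- **C1' (v15/v16's registered stub) — DERIVED from C1'' since v17.** Algebraic separating
functions on finite coverings of smooth irreducible affine `ℂ`-schemes (all relative dimensions):
a smooth irreducible `S` is smooth of some relative dimension `n`
(`Motives.exists_smoothOfRelativeDimension_of_smooth`); `n ≤ 1` is the tree's
`FundamentalGroup.algebraicSeparating_of_smoothOfRelativeDimension_le_one`, `n ≥ 2` is C1''. Name
and signature unchanged (consumed by `stub_riemannExistenceQbarDescent`).
[cite: SGA1, Exp. XII Thm. 5.1 (p. 333), proof, part 2] -/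
theorem stub_algebraicSeparatingSmoothAffine :
    ∀ (S : SchemeOver ℂ), IsAffine S.left → AlgebraicGeometry.Smooth S.hom →
      IrreducibleSpace S.left →
      ∀ (T : Type) [TopologicalSpace T] (q : T → ComplexPoints S) (_ : IsCoveringMap q)
        (_ : ∀ t, (q ⁻¹' {t}).Finite) (P₀ : ComplexPoints S),
        ∃ (h : T → ℂ) (F : Polynomial Γ(S.left, ⊤)), Continuous h ∧ F ≠ 0 ∧
          (∀ t, (F.map ((q t).evalRingHom ⊤ trivial)).eval (h t) = 0) ∧
          Set.InjOn h (q ⁻¹' {P₀}) := by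
  intro S hS hsm hirr T _ q hq hfin P₀
  haveI := hS; haveI := hsm; haveI := hirr
  obtain ⟨n, hn⟩ := Motives.exists_smoothOfRelativeDimension_of_smooth S.hom
  rcases Nat.lt_or_ge n 2 with hlt | hge
  · exact Literature.AlgebraicGeometry.FundamentalGroup.algebraicSeparating_of_smoothOfRelativeDimension_le_one
      (Nat.lt_succ_iff.mp hlt) S q hq hfin P₀
  · obtain ⟨m, rfl⟩ := Nat.exists_eq_add_of_le' hge
    exact stub_algebraicSeparatingSmoothAffineDimGeTwo m S hS hn hirr T q hq hfin P₀

/-- **C1'' ⟸ C1'** (the reshape v16 → v17 is a weakening): drop the dimension hypothesis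
(`SmoothOfRelativeDimension (n + 2)` ⟹ `Smooth`). -/
theorem stub_algebraicSeparatingSmoothAffineDimGeTwo_of_algebraicSeparatingSmoothAffine
    (H : ∀ (S : SchemeOver ℂ), IsAffine S.left → AlgebraicGeometry.Smooth S.hom →
      IrreducibleSpace S.left →
      ∀ (T : Type) [TopologicalSpace T] (q : T → ComplexPoints S) (_ : IsCoveringMap q)
        (_ : ∀ t, (q ⁻¹' {t}).Finite) (P₀ : ComplexPoints S),
        ∃ (h : T → ℂ) (F : Polynomial Γ(S.left, ⊤)), Continuous h ∧ F ≠ 0 ∧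
          (∀ t, (F.map ((q t).evalRingHom ⊤ trivial)).eval (h t) = 0) ∧
          Set.InjOn h (q ⁻¹' {P₀})) :
    ∀ (n : ℕ) (S : SchemeOver ℂ), IsAffine S.left → SmoothOfRelativeDimension (n + 2) S.hom →
      IrreducibleSpace S.left →
      ∀ (T : Type) [TopologicalSpace T] (q : T → ComplexPoints S) (_ : IsCoveringMap q)
        (_ : ∀ t, (q ⁻¹' {t}).Finite) (P₀ : ComplexPoints S),
        ∃ (h : T → ℂ) (F : Polynomial Γ(S.left, ⊤)), Continuous h ∧ F ≠ 0 ∧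
          (∀ t, (F.map ((q t).evalRingHom ⊤ trivial)).eval (h t) = 0) ∧
          Set.InjOn h (q ⁻¹' {P₀}) :=
  fun n S hS hn hirr T _ q hq hfin P₀ ↦ by
    haveI := hn
    exact H S hS (SmoothOfRelativeDimension.smooth (n + 2) S.hom) hirr T q hq hfin P₀

/-- **C1'' in relative dimension `≤ 1` is a THEOREM of the tree** (the discharged part of C1',
recorded as a certificate): `FundamentalGroup.algebraicSeparating_of_smoothOfRelativeDimension_le_one`.
[cite: SGA1, Exp. XII Thm. 5.1 (p. 333), proof, part 2] -/
theorem algebraicSeparatingSmoothAffine_of_le_one {n : ℕ} (hn : n ≤ 1) (S : SchemeOver ℂ)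
    [IsAffine S.left] [SmoothOfRelativeDimension n S.hom] [IrreducibleSpace S.left]
    {T : Type} [TopologicalSpace T] (q : T → ComplexPoints S) (hq : IsCoveringMap q)
    (hfin : ∀ t, (q ⁻¹' {t}).Finite) (P₀ : ComplexPoints S) :
    ∃ (h : T → ℂ) (F : Polynomial Γ(S.left, ⊤)), Continuous h ∧ F ≠ 0 ∧
      (∀ t, (F.map ((q t).evalRingHom ⊤ trivial)).eval (h t) = 0) ∧ Set.InjOn h (q ⁻¹' {P₀}) :=
  Literature.AlgebraicGeometry.FundamentalGroup.algebraicSeparating_of_smoothOfRelativeDimension_le_one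
    hn S q hq hfin P₀

/-- **C1' ⟸ C1** (the reshape v14 → v15 is a weakening): Riemann's existence theorem in covering
form for all quasi-projective `ℂ`-schemes (`FundamentalGroup.riemannExistence_finiteCovering`, v6–v14's
stub C1) gives in particular its smooth quasi-projective case
(`riemannExistence_smooth_of_riemannExistence_finiteCovering`), which is equivalent to C1'
(`riemannExistence_smooth_iff_algebraicSeparating`: integral separating functions by the Chinese
remainder theorem on the algebraised cover; a monic equation is non-zero on the integral `S`).
[cite: SGA1, Exp. XII Thm. 5.1 (p. 333)] -/
theorem stub_algebraicSeparatingSmoothAffine_of_riemannExistence_finiteCovering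
    (hRE : Literature.AlgebraicGeometry.FundamentalGroup.riemannExistence_finiteCovering) :
    ∀ (S : SchemeOver ℂ), IsAffine S.left → AlgebraicGeometry.Smooth S.hom →
      IrreducibleSpace S.left →
      ∀ (T : Type) [TopologicalSpace T] (q : T → ComplexPoints S) (_ : IsCoveringMap q)
        (_ : ∀ t, (q ⁻¹' {t}).Finite) (P₀ : ComplexPoints S),
        ∃ (h : T → ℂ) (F : Polynomial Γ(S.left, ⊤)), Continuous h ∧ F ≠ 0 ∧
          (∀ t, (F.map ((q t).evalRingHom ⊤ trivial)).eval (h t) = 0) ∧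
          Set.InjOn h (q ⁻¹' {P₀}) :=
  -- C1 ⟹ Riemann existence for smooth quasi-projective bases ⟹ C1' (both tree theorems)
  Literature.AlgebraicGeometry.FundamentalGroup.riemannExistence_smooth_iff_algebraicSeparating.1
    fun S hS hsm hirr T _ q hq hfin ↦ by
      haveI := hsm; haveI := hirr
      exact Literature.AlgebraicGeometry.FundamentalGroup.riemannExistence_smooth_of_riemannExistence_finiteCovering
        hRE S hS T q hq hfin

/-- **C1' ⟸ Riemann existence for SMOOTH irreducible quasi-projective bases** (the left-hand side of
the tree's `riemannExistence_smooth_iff_algebraicSeparating`): the registered stub is exactly the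
smooth case of Riemann's existence theorem in separating-function form. [cite: SGA1, Exp. XII Thm. 5.1 (p. 333)] -/
theorem stub_algebraicSeparatingSmoothAffine_of_riemannExistence_smooth
    (hRE : ∀ (S : SchemeOver ℂ), IsQuasiProjectiveOver S → AlgebraicGeometry.Smooth S.hom →
      IrreducibleSpace S.left →
      ∀ (T : Type) [TopologicalSpace T] (q : T → ComplexPoints S),
        IsCoveringMap q → (∀ t, (q ⁻¹' {t}).Finite) →
        ∃ (S' : SchemeOver ℂ) (g : S' ⟶ S) (Φ : ComplexPoints S' ≃ₜ T),
          IsFinite g.left ∧ Etale g.left ∧ ∀ z, q (Φ z) = AlgPoints.map g z) :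
    ∀ (S : SchemeOver ℂ), IsAffine S.left → AlgebraicGeometry.Smooth S.hom →
      IrreducibleSpace S.left →
      ∀ (T : Type) [TopologicalSpace T] (q : T → ComplexPoints S) (_ : IsCoveringMap q)
        (_ : ∀ t, (q ⁻¹' {t}).Finite) (P₀ : ComplexPoints S),
        ∃ (h : T → ℂ) (F : Polynomial Γ(S.left, ⊤)), Continuous h ∧ F ≠ 0 ∧
          (∀ t, (F.map ((q t).evalRingHom ⊤ trivial)).eval (h t) = 0) ∧
          Set.InjOn h (q ⁻¹' {P₀}) :=
  Literature.AlgebraicGeometry.FundamentalGroup.riemannExistence_smooth_iff_algebraicSeparating.1 hRE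

/-- **C2' — CONNECTED weak descent — PROVED and LANDED (lead c9, `Theorems.stub_connectedWeakDescentQbar`,
from the tree's `FundamentalGroup.finiteEtaleCover_weakDescent`, p125641).** Weak
descent of finite étale covers along `ℚ̄ ⊂ ℂ` for the covers the composition meets: a finite étale
cover `g : S' ⟶ S₀ ⊗_σ ℂ` of the complexification of a smooth irreducible quasi-projective
`ℚ̄`-scheme, with IRREDUCIBLE total space and CONNECTED complex points, is homeomorphic OVER `S(ℂ)`
to the complexification of a finite étale cover `g₀ : S''₀ ⟶ S₀` defined over `ℚ̄` (the consumed
part of SGA1 XIII Prop. 4.6). This is v6's `stub_weakDescentQbar` (verbatim the binder `hDescent` of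
`FundamentalGroup.riemannExistence_qbarDescent_of_finiteIndex_of_riemannExistence_of_weakDescent`,
p121703) weakened by the two extra hypotheses `IrreducibleSpace S'.left`,
`ConnectedSpace (ComplexPoints S')`: the reduction `…_of_coveringInput` only descends the cover that
Riemann existence attaches to a CONNECTED covering space, whose total space is smooth (étale over
smooth) with connected complex points, hence irreducible. It closes from the unrestricted weak
descent (`stub_connectedWeakDescentQbar_of_weakDescent`) — the form being delivered by spreading the
cover out over a `ℚ̄`-variety and specialising along a path (`Topology/CoveringSpaces/CoveringSliceTransport`,
`CoveringFamilyMonodromy` p121328, `Motives/ComplexPointsFiniteEtaleCovering`, `Limits/…Spread`), in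
progress under a Literature seat — and equally from descent of connected covers as an isomorphism of
schemes (`stub_connectedWeakDescentQbar_of_descent`, SGA1 XIII 4.6 as printed). -/
theorem stub_connectedWeakDescentQbar :
    ∀ (σ : AlgebraicClosure ℚ →+* ℂ) (S₀ : SchemeOver (AlgebraicClosure ℚ)),
      IsQuasiProjectiveOver S₀ → IrreducibleSpace S₀.left → AlgebraicGeometry.Smooth S₀.hom →
      ∀ ⦃S' : SchemeOver ℂ⦄ (g : S' ⟶ (baseChangeHom σ).obj S₀),
        IsFinite g.left → Etale g.left → IrreducibleSpace S'.left →
        ConnectedSpace (ComplexPoints S') →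
        ∃ (S''₀ : SchemeOver (AlgebraicClosure ℚ)) (g₀ : S''₀ ⟶ S₀)
          (Ψ : ComplexPoints ((baseChangeHom σ).obj S''₀) ≃ₜ ComplexPoints S'),
          IsFinite g₀.left ∧ Etale g₀.left ∧
            ∀ z, AlgPoints.map g (Ψ z) = AlgPoints.map ((baseChangeHom σ).map g₀) z :=
  -- = `Theorems.stub_connectedWeakDescentQbar` (p126502), whose proof is this term
  Theorems.linearSystemTorelli_connectedWeakDescent_of_weakDescent
    fun σ S₀ hqp hirr hsm _ g hfin het ↦
      Literature.AlgebraicGeometry.FundamentalGroup.finiteEtaleCover_weakDescent σ S₀ hqp hirr hsm g hfin het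

/-- **C (named fact) from C1' — PROVED (since v15 by the tree's
`riemannExistence_qbarDescent_of_finiteIndex_of_algebraicSeparating`; v7–v14 from C1 + C2' by
`Theorems.linearSystemTorelli_riemannExistence_qbarDescent_of_finiteIndex_of_riemannExistence_of_connectedWeakDescent`,
v9–v14 from C1 alone by p126127).** Riemann's existence theorem with descent of finite étale covers
to `ℚ̄` in the `π₁`/finite-index shape of the named fact
`FundamentalGroup.riemannExistence_qbarDescent_of_finiteIndex` (verbatim), consumed by B. Not a stub
of this skeleton. -/
theorem stub_riemannExistenceQbarDescent :
    Literature.AlgebraicGeometry.FundamentalGroup.riemannExistence_qbarDescent_of_finiteIndex :=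
  Literature.AlgebraicGeometry.FundamentalGroup.riemannExistence_qbarDescent_of_finiteIndex_of_algebraicSeparating
    stub_algebraicSeparatingSmoothAffine

/-- The v7–v14 derivation of C, kept as a certificate: C from Riemann existence over `ℂ` in covering
form (v6–v14's C1) and the CONNECTED weak descent C2' (lead c7's landed helper). -/
theorem stub_riemannExistenceQbarDescent_of_riemannExistence_finiteCovering
    (hRE : Literature.AlgebraicGeometry.FundamentalGroup.riemannExistence_finiteCovering) :
    Literature.AlgebraicGeometry.FundamentalGroup.riemannExistence_qbarDescent_of_finiteIndex :=
  Theorems.linearSystemTorelli_riemannExistence_qbarDescent_of_finiteIndex_of_riemannExistence_of_connectedWeakDescent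
    hRE stub_connectedWeakDescentQbar

/-- Since v9 the covering debt of the line is C1 alone: the named fact C follows from Riemann's
existence theorem over `ℂ` in covering form (`riemannExistence_finiteCovering`) and nothing else,
weak descent being PROVED in the tree (`FundamentalGroup.finiteEtaleCover_weakDescent`, p125641;
`Theorems.linearSystemTorelli_riemannExistence_qbarDescent_of_finiteIndex_of_riemannExistence`). -/
theorem stub_riemannExistenceQbarDescent_of_riemannExistence
    (hRiemann : Literature.AlgebraicGeometry.FundamentalGroup.riemannExistence_finiteCovering) :
    Literature.AlgebraicGeometry.FundamentalGroup.riemannExistence_qbarDescent_of_finiteIndex :=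
  -- the tree's p126127; = `Theorems.linearSystemTorelli_riemannExistence_qbarDescent_of_finiteIndex_of_riemannExistence` (p126502)
  Literature.AlgebraicGeometry.FundamentalGroup.riemannExistence_qbarDescent_of_finiteIndex_of_riemannExistence_finiteCovering
    hRiemann

/-- **C1's residue is ONE analytic existence statement (lead c15, v14).** The named fact
`FundamentalGroup.riemannExistence_finiteCovering` (stub C1: SGA 1 XII Thm. 5.1 in covering form)
follows from the existence of integral separating functions: for every affine `ℂ`-scheme `S` of
finite type with `Γ(S, 𝒪_S)` an integrally closed domain, every finite-fibred covering map
`q : T → S(ℂ)` and every `P₀ ∈ S(ℂ)`, a continuous `h : T → ℂ`, integral over `Γ(S, 𝒪_S)` and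
injective on `q⁻¹(P₀)` — the tree's `FundamentalGroup.riemannExistence_finiteCovering_of_integralSeparating`
(`RiemannExistenceNormalSeparating.lean`: reduction to a normal affine base by Milnor patching over
conductor / two-component squares, Noetherian induction, nilpotent thickenings and Zariski-local
glueing, then algebraisation by regular characteristic polynomials). The hypothesis is the
transcendental heart of Riemann's existence theorem (Grauert–Remmert, Serre's GAGA on a projective
closure, or Hörmander's `L²` estimates, plus Riemann extension across the singular locus of the normal
`S`); it is what remains of C1. [cite: SGA1, Exp. XII Thm. 5.1, proof, part 2] -/
theorem stub_riemannExistenceComplex_of_integralSeparating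
    (H : ∀ (S : SchemeOver ℂ), IsAffine S.left → LocallyOfFiniteType S.hom →
      IsDomain Γ(S.left, ⊤) → IsIntegrallyClosed Γ(S.left, ⊤) →
      ∀ (T : Type) [TopologicalSpace T] (q : T → ComplexPoints S) (_ : IsCoveringMap q)
        (_ : ∀ t, (q ⁻¹' {t}).Finite) (P₀ : ComplexPoints S),
        ∃ (h : T → ℂ) (R : Polynomial Γ(S.left, ⊤)), Continuous h ∧ R.Monic ∧
          (∀ t, (R.map ((q t).evalRingHom ⊤ trivial)).eval (h t) = 0) ∧
          Set.InjOn h (q ⁻¹' {P₀})) :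
    Literature.AlgebraicGeometry.FundamentalGroup.riemannExistence_finiteCovering :=
  Literature.AlgebraicGeometry.FundamentalGroup.riemannExistence_finiteCovering_of_integralSeparating H

/-- **D (route crux stmt-HodgeConjecture-16363, BY NAME since v8).** Deligne's théorème de la partie
fixe (Hodge II, Thm 4.1.1) as the route decl `Theses.LinearSystemTorelli.DeligneGlobalInvariantCycles`
(item stmt-HodgeConjecture-16363), which is the tree's named fact `deligne_globalInvariantCycles` with
`IsQuasiProjectiveOver S` unfolded (`stub_deligneGlobalInvariantCycles_iff`, `Iff.rfl`). Closes by
`exact Theses.LinearSystemTorelli.DeligneGlobalInvariantCycles_holds` when stmt-16363 closes, or by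
`stub_deligneGlobalInvariantCycles_iff.2 deligne_globalInvariantCycles_holds` if the fact is discharged
first. Residue after `deligne1968_…_holds`: a mixed Hodge structure package with Hodge II Cor. 3.2.17
(`stub_deligneGlobalInvariantCycles_of_mixedHodge`). -/
theorem stub_deligneGlobalInvariantCycles : Theses.LinearSystemTorelli.DeligneGlobalInvariantCycles := by
  sorry

/-- The route decl of stmt-16363 IS the named fact `deligne_globalInvariantCycles`: the former inlines
`IsQuasiProjectiveOver S` as `∃ (P) (j : S ⟶ P), IsProjectiveOver P ∧ IsOpenImmersion j.left`, the
latter's definition, so the two agree by `Iff.rfl` (the planner's certificate `SketchIff.lean`). -/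
theorem stub_deligneGlobalInvariantCycles_iff :
    Theses.LinearSystemTorelli.DeligneGlobalInvariantCycles ↔ deligne_globalInvariantCycles :=
  Iff.rfl

/-- D in the shape B consumes: the named fact `deligne_globalInvariantCycles`, from the stub by the
definitional `Iff`. -/
theorem deligneGlobalInvariantCycles_fact : deligne_globalInvariantCycles :=
  stub_deligneGlobalInvariantCycles_iff.1 stub_deligneGlobalInvariantCycles

/-- **D's residue is the simple-normal-crossings core of Voisin II, Prop. 4.23 (v15; tree event
2026-08-17T01:03Z).** Stub D — the route decl of stmt-16363, i.e. Deligne's partie fixe — follows from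
the inclusion `Im(ι^* : Hᵏ(𝒳(ℂ); ℂ) → Hᵏ(Y(ℂ); ℂ)) ⊆ Im((ι ≫ i)^* : Hᵏ(X'(ℂ); ℂ) → Hᵏ(Y(ℂ); ℂ))`
in the one case `hSNC` where `X'` is a smooth projective VARIETY and the complement of the open
immersion `i : 𝒳 ⟶ X'` is an snc boundary `⋃ⱼ V(Dⱼ)` with smooth strata, `ι : Y ⟶ 𝒳` a closed
immersion from a smooth projective variety — the exact setting of Deligne's logarithmic de Rham
complex (Hodge II, §3.1–3.2: `W_k = Im i^*` and strictness), which is what remains of D: the tree's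
`voisin2003_rangeRestrict_eq_of_compactification_of_snc` (`RestrictionImageOfCompactificationProofs`:
descent of image inclusions along `ℚ ⊆ ℂ`, reduction to an irreducible compactification, Kollár's
log resolution and the transfer of the pure part along it — all PROVED) gives the named fact
`voisin2003_rangeRestrict_eq_of_compactification`, and `deligne_globalInvariantCycles_of_rangeRestrict`
(with Deligne 1968 = `deligne1968_invariantClass_fromTotalSpace_holds`) the partie fixe.
[cite: VoisinHodgeII2003, Prop. 4.23 and Thm. 4.24] [cite: DeligneHodgeII1971, Thm. 3.2.5, Cor. 3.2.17, Thm. 4.1.1] -/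
theorem stub_deligneGlobalInvariantCycles_of_snc
    (hSNC : ∀ (𝒳 X' Y : SchemeOver ℂ) (i : 𝒳 ⟶ X') (ι : Y ⟶ 𝒳) (m n r : ℕ)
      (D : Fin r → X'.left.IdealSheafData),
      IsSmoothProjective m X' → IsOpenImmersion i.left → IsSmoothProjective n Y →
      IsClosedImmersion ι.left → Function.Injective D →
      (∀ I : Finset (Fin r),
        SmoothOfRelativeDimension (m - I.card) ((⨆ j ∈ I, D j).subschemeι ≫ X'.hom)) →
      (Set.range i.left.base)ᶜ = ⋃ j, ((D j).support : Set X'.left) →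
      ∀ k : ℕ, LinearMap.range (complexBetti.map ι k).hom ≤
        LinearMap.range (complexBetti.map (ι ≫ i) k).hom) :
    Theses.LinearSystemTorelli.DeligneGlobalInvariantCycles :=
  stub_deligneGlobalInvariantCycles_iff.2
    (deligne_globalInvariantCycles_of_rangeRestrict
      (voisin2003_rangeRestrict_eq_of_compactification_of_snc hSNC))

/-- **E (SECTOR, OPEN).** Divisor support with `ℚ̄`-rational support in codimension 2: for every
`σ`, every `ℚ̄`-scheme `W₀` with smooth projective complexification and every rational `(2,2)`-class
`c'` on `W₀ ⊗_σ ℂ`, there is a proper Zariski-closed `Z₀ ⊊ W₀` off whose preimage `c'` dies.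
Implied by the Hodge conjecture over `ℚ̄` in codimension 2 (`PeriodDeficiency.HodgeConjectureQbar`,
stmt-11596) ALONE (`stub_qbarDivisorSupportCodimTwo_of_hodgeConjectureQbar`: p117963 with the
Charles–Schnell `ℚ̄`-support fact, DISCHARGED as `charlesSchnell2014_algebraicClasses_supportedOn_qbarClosed_holds`);
PROVED for `m ≤ 3` (p121589); OPEN for `m ≥ 4`. -/
theorem stub_qbarDivisorSupportCodimTwo :
    ∀ (σ : AlgebraicClosure ℚ →+* ℂ) ⦃m : ℕ⦄ (W₀ : SchemeOver (AlgebraicClosure ℚ)),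
      IsSmoothProjective m ((baseChangeHom σ).obj W₀) →
      ∀ (c' : complexBetti ((baseChangeHom σ).obj W₀) 4), IsRationalClass c' →
        IsOfHodgeType m ((baseChangeHom σ).obj W₀) 4 2 2 c' →
          ∃ Z₀ : Set W₀.left, IsClosed Z₀ ∧ Z₀ ≠ Set.univ ∧
            complexBetti.restrictCompl ((baseChangeHom σ).obj W₀)
              ((baseChangeHomFst σ W₀).base ⁻¹' Z₀) 4 c' = 0 := by
  sorry

/-! ### v11 (lead c11): the E-side is exact; an items-only closure path (pointer) -/

/-- **E ⟹ HC/`ℚ̄`(·,2), for a fixed `σ` (lead c11; landed as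
`Theorems.linearSystemTorelli_hcQbarCodimTwo_of_qbarDivisorSupportCodimTwo`, p130143, inlined here so that the
skeleton does not import that module).** A rational `(2,2)`-class dying off the preimage of a proper
`ℚ̄`-closed `Z₀ ⊊ W₀` lies in `N¹H⁴` (the projection `W₀ ⊗ ℂ → W₀` is surjective, `W₀ ⊗ ℂ` integral),
hence is ALGEBRAIC: dimension `0` carries no `(2,2)`-class, and in dimension `k + 1` this is the route's
PROVED `DivisorInduction` (stmt-1082) at `p = 2` fed with Lefschetz `(1,1)` on `k`-folds (PROVED). -/
theorem hcQbarCodimTwo_of_qbarDivisorSupportCodimTwo (σ : AlgebraicClosure ℚ →+* ℂ)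
    (hE : ∀ ⦃m : ℕ⦄ (W₀ : SchemeOver (AlgebraicClosure ℚ)),
      IsSmoothProjective m ((baseChangeHom σ).obj W₀) →
      ∀ (c' : complexBetti ((baseChangeHom σ).obj W₀) 4), IsRationalClass c' →
        IsOfHodgeType m ((baseChangeHom σ).obj W₀) 4 2 2 c' →
          ∃ Z₀ : Set W₀.left, IsClosed Z₀ ∧ Z₀ ≠ Set.univ ∧
            complexBetti.restrictCompl ((baseChangeHom σ).obj W₀)
              ((baseChangeHomFst σ W₀).base ⁻¹' Z₀) 4 c' = 0) :
    ∀ ⦃m : ℕ⦄ ⦃W₀ : SchemeOver (AlgebraicClosure ℚ)⦄,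
      IsSmoothProjective m ((baseChangeHom σ).obj W₀) →
        ∀ (c' : complexBetti ((baseChangeHom σ).obj W₀) 4), IsRationalClass c' →
          IsOfHodgeType m ((baseChangeHom σ).obj W₀) 4 2 2 c' →
            c' ∈ algebraicClasses ((baseChangeHom σ).obj W₀) 2 := by
  intro m W₀ hW c' hc' hh'
  rcases m with _ | k
  · have h0 : c' = 0 := IsOfHodgeType.eq_zero_pp_of_lt (p := 2) hh' (by norm_num)
    rw [h0]
    exact Submodule.zero_mem _
  · obtain ⟨Z₀, hZ₀, hZ₀ne, hd⟩ := hE W₀ hW c' hc' hh'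
    have hclosed : IsClosed ((baseChangeHomFst σ W₀).base ⁻¹' Z₀) :=
      hZ₀.preimage (baseChangeHomFst σ W₀).base.hom.continuous
    have hne : (baseChangeHomFst σ W₀).base ⁻¹' Z₀ ≠ Set.univ :=
      Theorems.linearSystemTorelli_preimage_ne_univ_of_denseRange
        (surjective_baseChangeHomFst σ W₀).surj.denseRange hZ₀ hZ₀ne
    have hmem : c' ∈ supportedClasses ((baseChangeHom σ).obj W₀) (2 * 2) 1 :=
      mem_supportedClasses_of_restrictCompl_eq_zero hclosed
        (fun z hz ↦ by exact_mod_cast one_le_coheight_of_mem_of_isClosed hW hclosed hne hz) hd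
    exact Theorems.linearSystemTorelli_divisorInduction_proof k 2 (by norm_num)
      (fun Y hY c hc hh ↦ lefschetzOneOne_rational_holds hY c hc hh) hW c' hc' hh' hmem

/-- **The E-side is exact (lead c11, p130143: `Theorems.linearSystemTorelli_stub_qbarDivisorSupportCodimTwo_iff`).**
The registered stub E — VERBATIM its signature on the left — is EQUIVALENT to "for every `σ`, rational
`(2,2)`-classes on every smooth projective `W₀ ⊗_σ ℂ` are algebraic", the codimension-2 slice of
stmt-11596: `→` by `hcQbarCodimTwo_of_qbarDivisorSupportCodimTwo`, `←` by the discharged Charles–Schnell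
`ℚ̄`-support fact (`Theorems.linearSystemTorelli_qbarDivisorSupport_of_hcQbarCodimTwo`, p117963 + p124300). So the
`ℚ̄`-rationality of the supporting divisor is automatic and E cannot be cut below HC/`ℚ̄`(·,2). -/
theorem stub_qbarDivisorSupportCodimTwo_iff_hcQbarCodimTwo :
    (∀ (σ : AlgebraicClosure ℚ →+* ℂ) ⦃m : ℕ⦄ (W₀ : SchemeOver (AlgebraicClosure ℚ)),
      IsSmoothProjective m ((baseChangeHom σ).obj W₀) →
      ∀ (c' : complexBetti ((baseChangeHom σ).obj W₀) 4), IsRationalClass c' →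
        IsOfHodgeType m ((baseChangeHom σ).obj W₀) 4 2 2 c' →
          ∃ Z₀ : Set W₀.left, IsClosed Z₀ ∧ Z₀ ≠ Set.univ ∧
            complexBetti.restrictCompl ((baseChangeHom σ).obj W₀)
              ((baseChangeHomFst σ W₀).base ⁻¹' Z₀) 4 c' = 0) ↔
    (∀ (σ : AlgebraicClosure ℚ →+* ℂ) ⦃m : ℕ⦄ ⦃W₀ : SchemeOver (AlgebraicClosure ℚ)⦄,
      IsSmoothProjective m ((baseChangeHom σ).obj W₀) →
        ∀ (c' : complexBetti ((baseChangeHom σ).obj W₀) 4), IsRationalClass c' →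
          IsOfHodgeType m ((baseChangeHom σ).obj W₀) 4 2 2 c' →
            c' ∈ algebraicClasses ((baseChangeHom σ).obj W₀) 2) :=
  ⟨fun hE σ ↦ hcQbarCodimTwo_of_qbarDivisorSupportCodimTwo σ (hE σ),
    fun hQ σ _ W₀ ↦ Theorems.linearSystemTorelli_qbarDivisorSupport_of_hcQbarCodimTwo
      charlesSchnell2014_algebraicClasses_supportedOn_qbarClosed_holds σ (hQ σ) W₀⟩

/-- Hence stub E, as registered, yields the codimension-2 slice of HC/`ℚ̄` (the direction new in v11). -/
theorem hcQbarCodimTwo_of_stub_qbarDivisorSupportCodimTwo (σ : AlgebraicClosure ℚ →+* ℂ) :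
    ∀ ⦃m : ℕ⦄ ⦃W₀ : SchemeOver (AlgebraicClosure ℚ)⦄,
      IsSmoothProjective m ((baseChangeHom σ).obj W₀) →
        ∀ (c' : complexBetti ((baseChangeHom σ).obj W₀) 4), IsRationalClass c' →
          IsOfHodgeType m ((baseChangeHom σ).obj W₀) 4 2 2 c' →
            c' ∈ algebraicClasses ((baseChangeHom σ).obj W₀) 2 :=
  hcQbarCodimTwo_of_qbarDivisorSupportCodimTwo σ (stub_qbarDivisorSupportCodimTwo σ)

/- **Items-only closure path (lead c11)** — LANDED as
`Theorems.linearSystemTorelli_middleDivisorSupportFourfold_of_typeStability_of_finiteMonodromyAlgebraicOfQbar`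
(p130292, --supports 2409) and deliberately NOT restated here, so that the registered composition of this
skeleton stays `MiddleDivisorSupportFourfold_of`: the crux from A' together with
`PeriodDeficiency.FiniteMonodromyAlgebraicOfQbar` (stmt-15380: Voisin's finite-monodromy step, which packages
Riemann existence, Deligne's partie fixe and Fulton's pull-back inside ONE existing item) and
`PeriodDeficiency.HodgeConjectureQbar` (stmt-11596) — spread, finite orbit from A', algebraicity on `𝒳_s` by
stmt-15380 + HC/`ℚ̄`, transport along `e`, `N² ⊆ N¹`.  C1 and D remain the line's own, finer, debts. -/

/- **Items-only closure paths through the absolute-Hodge funnel (lead c15)** — LANDED as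
`Theorems.linearSystemTorelli_middleDivisorSupportFourfold_of_absoluteHodge_of_absoluteReduction`
(crux ⟸ AH(4,2) ∧ `BoundaryReadout.HCOverNumberFields` (stmt-1070) ∧ `BoundaryReadout.AbsoluteReduction`
(stmt-15945 = Voisin 2007 Prop. 1.2 as a route item): absolute ⟹ algebraic ⟹ `N² ⊆ N¹`) and
`Theorems.linearSystemTorelli_middleDivisorSupportFourfold_of_weaklyAbsoluteHodge_of_voisin2007`
(crux ⟸ WAH(4,2) ∧ `PeriodDeficiency.HodgeConjectureQbar` (stmt-11596) modulo the named fact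
`voisin2007_hodgeConjecture_weaklyAbsolute_of_qbar`), p134157, --supports 2409, two registered
sub-goals; deliberately NOT restated here, so that the registered composition of this skeleton stays
`MiddleDivisorSupportFourfold_of`.  They locate the line's kernel: AH(4,2) ⟹ WAH(4,2) ⟹ (Voisin 2007
Thm. 0.5 (2) + Cattani–Deligne–Kaplan, not kernel-checked) ⟹ T = A'. -/

/-! ### Composition: the stubs conclude the crux BY NAME -/

/-- **DominantQbarEnvelope(4,2) from A and B (with C, D).** For a fixed `σ`: spread `X`, take the
dominant envelope of the transported class on `𝒳_s`, and precompose with `e : X ≅ 𝒳_s`. -/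
theorem dominantQbarEnvelopeFourfoldCodimTwo (σ : AlgebraicClosure ℚ →+* ℂ) :
    ∀ ⦃X : SchemeOver ℂ⦄, IsSmoothProjective 4 X → ∀ (c : complexBetti X 4), IsRationalClass c →
      IsOfHodgeType 4 X 4 2 2 c →
        ∃ (m : ℕ) (W₀ : SchemeOver (AlgebraicClosure ℚ)) (ι : X ⟶ (baseChangeHom σ).obj W₀)
          (c' : complexBetti ((baseChangeHom σ).obj W₀) 4),
          IsSmoothProjective m ((baseChangeHom σ).obj W₀) ∧
          DenseRange (ι.left ≫ baseChangeHomFst σ W₀).base ∧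
          IsRationalClass c' ∧ IsOfHodgeType m ((baseChangeHom σ).obj W₀) 4 2 2 c' ∧
          complexBetti.map ι 4 c' = c := by
  intro X hX c hc hh
  obtain ⟨𝒳₀, S₀, f₀, s, e, h𝒳₀, hS₀, hirr, hsm, hf, hgen, hfin⟩ :=
    stub_finiteMonodromyAtGenericSpread σ hX c hc hh
  obtain ⟨m, W₀, ι, c', hW, hdom, hc', hh', hmap⟩ :=
    stub_dominantEnvelopeOfFiniteMonodromy stub_riemannExistenceQbarDescent
      deligneGlobalInvariantCycles_fact σ f₀ 4 2 h𝒳₀ hS₀ hirr hsm hf s hgen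
      (complexBetti.map e.inv 4 c) (hc.map _) (hh.map_of_iso e.symm) hfin
  refine ⟨m, W₀, e.hom ≫ ι, c', hW, ?_, hc', hh', ?_⟩
  · -- dense range survives precomposition with the homeomorphism `e(ℂ)`… here `e` on schemes
    have hsurj : Function.Surjective e.hom.left.base := by
      have : IsIso e.hom.left := inferInstance
      exact e.hom.left.surjective
    have : ((e.hom ≫ ι).left ≫ baseChangeHomFst σ W₀).base =
        e.hom.left.base ≫ (ι.left ≫ baseChangeHomFst σ W₀).base := rfl
    rw [this, TopCat.coe_comp]
    exact hdom.comp hsurj.denseRange (ι.left ≫ baseChangeHomFst σ W₀).base.hom.continuous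
  · rw [complexBetti.map_comp, ModuleCat.comp_apply, hmap]
    exact e.complexBetti_map_hom_map_inv 4 c

/-- The line closes the crux modulo its stubs (A', C1, D, E open): fix an embedding `σ : ℚ̄ →+* ℂ`
(`exists_ringHom_algebraicClosure_rat_complex`); A + B (with C, D) give the dominant `ℚ̄`-envelope
of every rational `(2,2)`-class on every fourfold, E the `ℚ̄`-rational divisor support upstairs, and
the landed glue `linearSystemTorelli_middleDivisorSupportFourfold_of_dominantQbarEnvelope` (p117963)
concludes. -/
theorem MiddleDivisorSupportFourfold_of : Theses.LinearSystemTorelli.MiddleDivisorSupportFourfold := by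
  obtain ⟨σ⟩ := exists_ringHom_algebraicClosure_rat_complex
  exact Theorems.linearSystemTorelli_middleDivisorSupportFourfold_of_dominantQbarEnvelope σ
    (dominantQbarEnvelopeFourfoldCodimTwo σ) (stub_qbarDivisorSupportCodimTwo σ)

/-! ### Sanity (sorry-free): each open stub is implied by an existing item / named fact -/

/-- **v10 is a weakening of v9 on the A-side.** A' is implied by `PeriodDeficiency.ClassicalGeometricVHS`
(stmt-11597) and `PeriodDeficiency.QbarGenericIsHodgeGeneric` (stmt-11595) together with the single
remaining classical input `hType` of the tree's `bku_finite_monodromyOrbit_of_isHodgeGenericIn_of_hType`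
(type stability of monodromy translates at a point of maximal Mumford–Tate rank; Deligne 1972 Prop. 7.5,
André 1992 Thm. 1), VERBATIM — whereas v9's A needed stmt-11597 ∧ stmt-11595 ∧ the whole BKU fact
(landed certificate `Theorems.linearSystemTorelli_typeStabilityAtQbarGeneric_of_qbarGenericIsHodgeGeneric_of_hType`, p127337). -/
theorem stub_typeStabilityAtQbarGeneric_of_qbarGenericIsHodgeGeneric_of_hType
    (hC : Theses.PeriodDeficiency.ClassicalGeometricVHS)
    (hG : Theses.PeriodDeficiency.QbarGenericIsHodgeGeneric)
    (hType : ∀ [HodgeTensorFacts.{0, 0}] (σ : AlgebraicClosure ℚ →+* ℂ)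
      ⦃𝒳₀ S₀ : SchemeOver (AlgebraicClosure ℚ)⦄ (f₀ : 𝒳₀ ⟶ S₀) (n p : ℕ)
      (hf : IsSmoothProjectiveFamily ((baseChangeHom σ).map f₀) n)
      (_ : IsQuasiProjectiveOver 𝒳₀) (hS₀ : IsQuasiProjectiveOver S₀) [IrreducibleSpace S₀.left]
      [AlgebraicGeometry.Smooth S₀.hom]
      (A : ∀ t : ComplexPoints ((baseChangeHom σ).obj S₀),
          HodgeModel n (fiberOver ((baseChangeHom σ).map f₀) t))
      (hA : ∀ t, (A t).IsHodgeSymmetric)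
      [∀ t, Module.Finite ℚ
        (singularCohomology ℚ ℚ (ComplexPoints (fiberOver ((baseChangeHom σ).map f₀) t)) (2 * p))]
      (s : ComplexPoints ((baseChangeHom σ).obj S₀)),
      (∀ t, ((A t).hodgeStructure (hf.isSmoothProjective t) (hA t) (2 * p)).mtRank ≤
          ((A s).hodgeStructure (hf.isSmoothProjective s) (hA s) (2 * p)).mtRank) →
      ∀ (α : complexBetti (fiberOver ((baseChangeHom σ).map f₀) s) (2 * p)),
        IsRationalClass α → IsOfHodgeType n (fiberOver ((baseChangeHom σ).map f₀) s) (2 * p) p p α →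
        ∀ γ : Path.Homotopic.Quotient
            (⟨s, Set.mem_univ s⟩ : (Set.univ : Set (ComplexPoints ((baseChangeHom σ).obj S₀))))
            ⟨s, Set.mem_univ s⟩,
          IsOfHodgeType n (fiberOver ((baseChangeHom σ).map f₀) s) (2 * p) p p
            (transportFun ((baseChangeHom σ).map f₀) (2 * p)
              (isCohomologicallyLocallyTrivialOn_univ_baseChangeHom σ f₀ hf hS₀) γ α :)) :
    ∀ (σ : AlgebraicClosure ℚ →+* ℂ) ⦃𝒳₀ S₀ : SchemeOver (AlgebraicClosure ℚ)⦄ (f₀ : 𝒳₀ ⟶ S₀),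
      IsQuasiProjectiveOver 𝒳₀ → IsQuasiProjectiveOver S₀ → IrreducibleSpace S₀.left →
      AlgebraicGeometry.Smooth S₀.hom → IsSmoothProjectiveFamily ((baseChangeHom σ).map f₀) 4 →
      ∀ (s : ComplexPoints ((baseChangeHom σ).obj S₀)),
        closure {(baseChangeHomFst σ S₀).base s.pt} = (Set.univ : Set S₀.left) →
        ∀ (α : complexBetti (fiberOver ((baseChangeHom σ).map f₀) s) 4),
          IsRationalClass α → IsOfHodgeType 4 (fiberOver ((baseChangeHom σ).map f₀) s) 4 2 2 α →
          ∀ (γ : Path s s) (β : complexBetti (fiberOver ((baseChangeHom σ).map f₀) s) 4),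
            IsContinuationAlong γ α β →
              IsOfHodgeType 4 (fiberOver ((baseChangeHom σ).map f₀) s) 4 2 2 β := by
  -- = `Theorems.linearSystemTorelli_typeStabilityAtQbarGeneric_of_qbarGenericIsHodgeGeneric_of_hType hC hG hType` (p127337)
  intro σ 𝒳₀ S₀ f₀ h𝒳₀ hS₀ hirr hsm hf s hgen α hα hh γ β hβ
  haveI := hirr
  haveI := hsm
  obtain ⟨B, hBc, hTF, hD⟩ := hC
  haveI : HodgeTensorFacts.{0, 0} := hTF
  obtain ⟨D, hfin⟩ := hD σ f₀ 4 (2 * 2) hf hirr hsm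
  haveI : ∀ t, Module.Finite ℚ (D.V.fiber t) := hfin
  have hHG := hG B hBc σ f₀ 4 (2 * 2) D hirr hsm s
  have hW : (⋂₀ {Z | IsDefinedOverQbar σ S₀ Z ∧ s ∈ Z}) =
      (Set.univ : Set (ComplexPoints ((baseChangeHom σ).obj S₀))) := by
    rw [Set.sInter_eq_univ]
    rintro Z ⟨hZ, hsZ⟩
    haveI : LocallyOfFiniteType S₀.hom := locallyOfFiniteType_of_isQuasiProjectiveOver hS₀
    exact hZ.eq_univ_of_closure_base_pt_eq_univ hsZ hgen
  rw [hW] at hHG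
  choose A hA using fun t : ComplexPoints ((baseChangeHom σ).obj S₀) ↦
    exists_isReal_hodgeModel_holds.exists_isHodgeSymmetric (hf.isSmoothProjective t)
  haveI : ∀ t : ComplexPoints ((baseChangeHom σ).obj S₀), Module.Finite ℚ
      (singularCohomology ℚ ℚ (ComplexPoints (fiberOver ((baseChangeHom σ).map f₀) t)) (2 * 2)) :=
    fun t ↦ finite_singularCohomology_rat_complexPoints (hf.isSmoothProjective t) (2 * 2)
  have hgen' : ∀ t, ((A t).hodgeStructure (hf.isSmoothProjective t) (hA t) (2 * 2)).mtRank ≤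
      ((A s).hodgeStructure (hf.isSmoothProjective s) (hA s) (2 * 2)).mtRank := by
    intro t
    have ht := hHG.2 t (Set.mem_univ t)
    rwa [D.mtRankAt_eq_mtRank_hodgeStructure hBc (A t) (hA t),
      D.mtRankAt_eq_mtRank_hodgeStructure hBc (A s) (hA s)] at ht
  have hβ' := (isContinuationAlong_iff_transportFun_eq ((baseChangeHom σ).map f₀) (2 * 2)
    (isCohomologicallyLocallyTrivialOn_univ_baseChangeHom σ f₀ hf hS₀) γ α β).1 hβ
  subst hβ'
  exact hType σ f₀ 4 2 hf h𝒳₀ hS₀ A hA s hgen' α hα hh _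

/-- **A' ⟸ A (∀-form) modulo C1 and D (lead c14, p132947).** The registered kernel
`stub_typeStabilityAtQbarGeneric` follows from Riemann existence in covering form (stub C1), the
partie fixe (stub D, the route decl) and the ∀-form of finite monodromy at `ℚ̄`-generic points —
`Theorems.linearSystemTorelli_typeStabilityAtQbarGeneric_of_forall_finite`. Together with
`stub_finiteMonodromyAtGenericSpread_of_typeStabilityAtQbarGeneric` (A ⟸ A', unconditional) this
records that inside the line T and "finite monodromy at `ℚ̄`-generic points" are the same input. -/
theorem stub_typeStabilityAtQbarGeneric_of_forall_finite
    (hC1 : Literature.AlgebraicGeometry.FundamentalGroup.riemannExistence_finiteCovering)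
    (hD : Theses.LinearSystemTorelli.DeligneGlobalInvariantCycles)
    (hA : ∀ (σ : AlgebraicClosure ℚ →+* ℂ) ⦃𝒳₀ S₀ : SchemeOver (AlgebraicClosure ℚ)⦄
      (f₀ : 𝒳₀ ⟶ S₀), IsQuasiProjectiveOver 𝒳₀ → IsQuasiProjectiveOver S₀ →
      IrreducibleSpace S₀.left → AlgebraicGeometry.Smooth S₀.hom →
      IsSmoothProjectiveFamily ((baseChangeHom σ).map f₀) 4 →
      ∀ (s : ComplexPoints ((baseChangeHom σ).obj S₀)),
        closure {(baseChangeHomFst σ S₀).base s.pt} = (Set.univ : Set S₀.left) →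
        ∀ (α : complexBetti (fiberOver ((baseChangeHom σ).map f₀) s) 4),
          IsRationalClass α → IsOfHodgeType 4 (fiberOver ((baseChangeHom σ).map f₀) s) 4 2 2 α →
          {β : complexBetti (fiberOver ((baseChangeHom σ).map f₀) s) 4 |
            ∃ γ : Path s s, IsContinuationAlong γ α β}.Finite) :
    ∀ (σ : AlgebraicClosure ℚ →+* ℂ) ⦃𝒳₀ S₀ : SchemeOver (AlgebraicClosure ℚ)⦄ (f₀ : 𝒳₀ ⟶ S₀),
      IsQuasiProjectiveOver 𝒳₀ → IsQuasiProjectiveOver S₀ → IrreducibleSpace S₀.left →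
      AlgebraicGeometry.Smooth S₀.hom → IsSmoothProjectiveFamily ((baseChangeHom σ).map f₀) 4 →
      ∀ (s : ComplexPoints ((baseChangeHom σ).obj S₀)),
        closure {(baseChangeHomFst σ S₀).base s.pt} = (Set.univ : Set S₀.left) →
        ∀ (α : complexBetti (fiberOver ((baseChangeHom σ).map f₀) s) 4),
          IsRationalClass α → IsOfHodgeType 4 (fiberOver ((baseChangeHom σ).map f₀) s) 4 2 2 α →
          ∀ (γ : Path s s) (β : complexBetti (fiberOver ((baseChangeHom σ).map f₀) s) 4),
            IsContinuationAlong γ α β →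
              IsOfHodgeType 4 (fiberOver ((baseChangeHom σ).map f₀) s) 4 2 2 β :=
  Theorems.linearSystemTorelli_typeStabilityAtQbarGeneric_of_forall_finite hC1 hD hA

/-- **A, unconditionally from ANY proof of A'** (the shape in which the skeleton consumes A'; a
general rational class all of whose loop-continuations are `(p,p)` has finite monodromy orbit,
`Theorems.linearSystemTorelli_finite_setOf_isContinuationAlong_of_forall_isOfHodgeType`, p127337). -/
theorem stub_finiteMonodromyAtGenericSpread_of_typeStabilityAtQbarGeneric
    (hT : ∀ (σ : AlgebraicClosure ℚ →+* ℂ) ⦃𝒳₀ S₀ : SchemeOver (AlgebraicClosure ℚ)⦄ (f₀ : 𝒳₀ ⟶ S₀),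
      IsQuasiProjectiveOver 𝒳₀ → IsQuasiProjectiveOver S₀ → IrreducibleSpace S₀.left →
      AlgebraicGeometry.Smooth S₀.hom → IsSmoothProjectiveFamily ((baseChangeHom σ).map f₀) 4 →
      ∀ (s : ComplexPoints ((baseChangeHom σ).obj S₀)),
        closure {(baseChangeHomFst σ S₀).base s.pt} = (Set.univ : Set S₀.left) →
        ∀ (α : complexBetti (fiberOver ((baseChangeHom σ).map f₀) s) 4),
          IsRationalClass α → IsOfHodgeType 4 (fiberOver ((baseChangeHom σ).map f₀) s) 4 2 2 α →
          ∀ (γ : Path s s) (β : complexBetti (fiberOver ((baseChangeHom σ).map f₀) s) 4),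
            IsContinuationAlong γ α β →
              IsOfHodgeType 4 (fiberOver ((baseChangeHom σ).map f₀) s) 4 2 2 β) :
    ∀ (σ : AlgebraicClosure ℚ →+* ℂ) ⦃X : SchemeOver ℂ⦄, IsSmoothProjective 4 X →
      ∀ (c : complexBetti X 4), IsRationalClass c → IsOfHodgeType 4 X 4 2 2 c →
        ∃ (𝒳₀ S₀ : SchemeOver (AlgebraicClosure ℚ)) (f₀ : 𝒳₀ ⟶ S₀)
          (s : ComplexPoints ((baseChangeHom σ).obj S₀))
          (e : X ≅ fiberOver ((baseChangeHom σ).map f₀) s),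
          IsQuasiProjectiveOver 𝒳₀ ∧ IsQuasiProjectiveOver S₀ ∧ IrreducibleSpace S₀.left ∧
          AlgebraicGeometry.Smooth S₀.hom ∧
          IsSmoothProjectiveFamily ((baseChangeHom σ).map f₀) 4 ∧
          closure {(baseChangeHomFst σ S₀).base s.pt} = (Set.univ : Set S₀.left) ∧
          {β : complexBetti (fiberOver ((baseChangeHom σ).map f₀) s) 4 |
              ∃ γ : Path s s, IsContinuationAlong γ (complexBetti.map e.inv 4 c) β}.Finite := by
  -- = `Theorems.stub_finiteMonodromyAtGenericSpread_of_typeStabilityAtQbarGeneric hT` (p127337)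
  intro σ X hX c hc hh
  obtain ⟨𝒳₀, S₀, f₀, s, h𝒳₀, hS₀, hirr, hsm, hf, hgen, ⟨e⟩⟩ :=
    spreadingOut_smoothProjective_qbarFamily_holds σ hX
  refine ⟨𝒳₀, S₀, f₀, s, e, h𝒳₀, hS₀, hirr, hsm, hf, hgen, ?_⟩
  exact finite_setOf_isContinuationAlong_of_forall_isOfHodgeType σ f₀ 4 2 hf h𝒳₀ hS₀ hirr hsm s
    (complexBetti.map e.inv 4 c) (hc.map _)
    (hT σ f₀ h𝒳₀ hS₀ hirr hsm hf s hgen (complexBetti.map e.inv 4 c) (hc.map _) (hh.map_of_iso e.symm))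

/-- A is implied by `PeriodDeficiency.ClassicalGeometricVHS` (stmt-11597) and
`PeriodDeficiency.QbarGenericIsHodgeGeneric` (stmt-11595) modulo the named fact
`bku_finite_monodromyOrbit_of_isHodgeGenericIn` (landed, p119481; the spreading-out fact is proved). -/
theorem stub_finiteMonodromyAtGenericSpread_of_qbarGenericIsHodgeGeneric
    (hC : Theses.PeriodDeficiency.ClassicalGeometricVHS)
    (hG : Theses.PeriodDeficiency.QbarGenericIsHodgeGeneric)
    (hB : bku_finite_monodromyOrbit_of_isHodgeGenericIn) :
    ∀ (σ : AlgebraicClosure ℚ →+* ℂ) ⦃X : SchemeOver ℂ⦄, IsSmoothProjective 4 X →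
      ∀ (c : complexBetti X 4), IsRationalClass c → IsOfHodgeType 4 X 4 2 2 c →
        ∃ (𝒳₀ S₀ : SchemeOver (AlgebraicClosure ℚ)) (f₀ : 𝒳₀ ⟶ S₀)
          (s : ComplexPoints ((baseChangeHom σ).obj S₀))
          (e : X ≅ fiberOver ((baseChangeHom σ).map f₀) s),
          IsQuasiProjectiveOver 𝒳₀ ∧ IsQuasiProjectiveOver S₀ ∧ IrreducibleSpace S₀.left ∧
          AlgebraicGeometry.Smooth S₀.hom ∧
          IsSmoothProjectiveFamily ((baseChangeHom σ).map f₀) 4 ∧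
          closure {(baseChangeHomFst σ S₀).base s.pt} = (Set.univ : Set S₀.left) ∧
          {β : complexBetti (fiberOver ((baseChangeHom σ).map f₀) s) 4 |
              ∃ γ : Path s s, IsContinuationAlong γ (complexBetti.map e.inv 4 c) β}.Finite :=
  Theorems.stub_finiteMonodromyAtGenericSpread_of_qbarGenericIsHodgeGeneric hC hG hB

/-- E is implied by `PeriodDeficiency.HodgeConjectureQbar` (stmt-11596) ALONE: the reduction p117963
with its Charles–Schnell input supplied by the tree's DISCHARGE
`charlesSchnell2014_algebraicClasses_supportedOn_qbarClosed_holds` (p124300, 2026-08-16T20:09Z). -/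
theorem stub_qbarDivisorSupportCodimTwo_of_hodgeConjectureQbar
    (h : Theses.PeriodDeficiency.HodgeConjectureQbar) :
    ∀ (σ : AlgebraicClosure ℚ →+* ℂ) ⦃m : ℕ⦄ (W₀ : SchemeOver (AlgebraicClosure ℚ)),
      IsSmoothProjective m ((baseChangeHom σ).obj W₀) →
      ∀ (c' : complexBetti ((baseChangeHom σ).obj W₀) 4), IsRationalClass c' →
        IsOfHodgeType m ((baseChangeHom σ).obj W₀) 4 2 2 c' →
          ∃ Z₀ : Set W₀.left, IsClosed Z₀ ∧ Z₀ ≠ Set.univ ∧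
            complexBetti.restrictCompl ((baseChangeHom σ).obj W₀)
              ((baseChangeHomFst σ W₀).base ⁻¹' Z₀) 4 c' = 0 :=
  fun σ ↦ Theorems.linearSystemTorelli_qbarDivisorSupport_of_hodgeConjectureQbar
    charlesSchnell2014_algebraicClasses_supportedOn_qbarClosed_holds h σ

/-- E holds UNCONDITIONALLY in dimension `m ≤ 3` (landed p121589, lead c4's wave: off a non-empty affine
`ℚ̄`-open `U₀ ⊆ W₀` every class of `H⁴` dies, since `H₄((U₀ ⊗ ℂ)(ℂ)) = 0` by Andreotti–Frankel for the
smooth affine `m`-fold `U₀ ⊗ ℂ`, `m + 1 ≤ 4`); so E's open content is exactly `m ≥ 4`. -/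
theorem stub_qbarDivisorSupportCodimTwo_of_le_three :
    ∀ (σ : AlgebraicClosure ℚ →+* ℂ) ⦃m : ℕ⦄, m ≤ 3 → ∀ (W₀ : SchemeOver (AlgebraicClosure ℚ)),
      IsSmoothProjective m ((baseChangeHom σ).obj W₀) →
      ∀ (c' : complexBetti ((baseChangeHom σ).obj W₀) 4), IsRationalClass c' →
        IsOfHodgeType m ((baseChangeHom σ).obj W₀) 4 2 2 c' →
          ∃ Z₀ : Set W₀.left, IsClosed Z₀ ∧ Z₀ ≠ Set.univ ∧
            complexBetti.restrictCompl ((baseChangeHom σ).obj W₀)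
              ((baseChangeHomFst σ W₀).base ⁻¹' Z₀) 4 c' = 0 :=
  Theorems.linearSystemTorelli_stub_qbarDivisorSupportCodimTwo_of_le_three

/-- D's residue after the tree's discharge of Deligne 1968 (`deligne1968_invariantClass_fromTotalSpace_holds`,
Voisin II Thm. 4.18 for smooth projective families): the partie fixe (stub D, the route decl
`Theses.LinearSystemTorelli.DeligneGlobalInvariantCycles` = `deligne_globalInvariantCycles`)
follows from ANY package `M` of Deligne's mixed Hodge structures on pairs of complex varieties
(`Motives.MixedHodgeStructureOfPair ℂ`; inhabitedness is the named fact `existsDeligne`) that satisfies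
Hodge II, Cor. 3.2.17 (`W_k Hᵏ(𝒳) ⊆ Im(Hᵏ(𝒳̄) → Hᵏ(𝒳))` for open immersions into smooth projective
`𝒳̄`) — the tree's `deligne_globalInvariantCycles_of_deligne1968_of_cor3217` with its first input supplied. -/
theorem stub_deligneGlobalInvariantCycles_of_mixedHodge (M : MixedHodgeStructureOfPair ℂ)
    (h3217 : ∀ (𝒳 Xbar : SchemeOver ℂ) (i : 𝒳 ⟶ Xbar) (m : ℕ),
      IsProjectiveOver Xbar → SmoothOfRelativeDimension m Xbar.hom → IsOpenImmersion i.left →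
      ∀ k : ℕ, (M.mhs (SchemePair.ofScheme 𝒳) k).W k ≤
        LinearMap.range (SchemePair.bettiCohomology.map (SchemePair.Hom.ofScheme i) k).hom) :
    Theses.LinearSystemTorelli.DeligneGlobalInvariantCycles :=
  stub_deligneGlobalInvariantCycles_iff.2
    (deligne_globalInvariantCycles_of_deligne1968_of_cor3217
      deligne1968_invariantClass_fromTotalSpace_holds M h3217)


/-- **D ⟸ Voisin II Prop. 4.23 alone (lead c14, p133108).** The route decl
`Theses.LinearSystemTorelli.DeligneGlobalInvariantCycles` (stub D = stmt-16363 = the named fact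
`deligne_globalInvariantCycles` by `Iff.rfl`) follows from the single named fact
`voisin2003_rangeRestrict_eq_of_compactification` (Voisin II Prop. 4.23: the images of `Hᵏ(𝒳̄; ℚ)` and
`Hᵏ(𝒳; ℚ)` in `Hᵏ(Y; ℚ)` agree for closed smooth projective `Y ⊂ 𝒳 ⊂ 𝒳̄`), by the tree's
`deligne_globalInvariantCycles_of_rangeRestrict` (Thm. 4.18 = `deligne1968_invariantClass_fromTotalSpace_holds`
PROVED; Prop. 4.23 for `𝒳_{s₀} ⊂ 𝒳 ⊂ 𝒳̄`; `ℚ → ℂ` comparison; assembly). So D closes by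
`stub_deligneGlobalInvariantCycles_of_rangeRestrict voisin2003_rangeRestrict_eq_of_compactification_holds`
the day that one proposition is discharged (Hodge II §3.2; or any mixed-Hodge package with 3.2.17, by
`voisin2003_rangeRestrict_eq_of_compactification_of_mixedHodge`, cf. `stub_deligneGlobalInvariantCycles_of_mixedHodge`). -/
theorem stub_deligneGlobalInvariantCycles_of_rangeRestrict
    (h : voisin2003_rangeRestrict_eq_of_compactification) :
    Theses.LinearSystemTorelli.DeligneGlobalInvariantCycles :=
  stub_deligneGlobalInvariantCycles_iff.2 (deligne_globalInvariantCycles_of_rangeRestrict h)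
/-- C2' is implied by v6's C2, the unrestricted weak descent (binder `hDescent` of p121703): drop the
two extra hypotheses (`Theorems.linearSystemTorelli_connectedWeakDescent_of_weakDescent`). So v7 is a
WEAKENING of v6: whatever closes v6's `stub_weakDescentQbar` closes `stub_connectedWeakDescentQbar`. -/
theorem stub_connectedWeakDescentQbar_of_weakDescent
    (hDescent : ∀ (σ : AlgebraicClosure ℚ →+* ℂ) (S₀ : SchemeOver (AlgebraicClosure ℚ)),
      IsQuasiProjectiveOver S₀ → IrreducibleSpace S₀.left → AlgebraicGeometry.Smooth S₀.hom →
      ∀ ⦃S' : SchemeOver ℂ⦄ (g : S' ⟶ (baseChangeHom σ).obj S₀),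
        IsFinite g.left → Etale g.left →
        ∃ (S''₀ : SchemeOver (AlgebraicClosure ℚ)) (g₀ : S''₀ ⟶ S₀)
          (Ψ : ComplexPoints ((baseChangeHom σ).obj S''₀) ≃ₜ ComplexPoints S'),
          IsFinite g₀.left ∧ Etale g₀.left ∧
            ∀ z, AlgPoints.map g (Ψ z) = AlgPoints.map ((baseChangeHom σ).map g₀) z) :
    ∀ (σ : AlgebraicClosure ℚ →+* ℂ) (S₀ : SchemeOver (AlgebraicClosure ℚ)),
      IsQuasiProjectiveOver S₀ → IrreducibleSpace S₀.left → AlgebraicGeometry.Smooth S₀.hom →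
      ∀ ⦃S' : SchemeOver ℂ⦄ (g : S' ⟶ (baseChangeHom σ).obj S₀),
        IsFinite g.left → Etale g.left → IrreducibleSpace S'.left →
        ConnectedSpace (ComplexPoints S') →
        ∃ (S''₀ : SchemeOver (AlgebraicClosure ℚ)) (g₀ : S''₀ ⟶ S₀)
          (Ψ : ComplexPoints ((baseChangeHom σ).obj S''₀) ≃ₜ ComplexPoints S'),
          IsFinite g₀.left ∧ Etale g₀.left ∧
            ∀ z, AlgPoints.map g (Ψ z) = AlgPoints.map ((baseChangeHom σ).map g₀) z :=
  Theorems.linearSystemTorelli_connectedWeakDescent_of_weakDescent hDescent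

/-- C2' is also implied by descent of CONNECTED finite étale covers as an isomorphism of schemes
(the binder `hDescent` of `HodgeTheory.finiteCovering_descends_to_qbar_of_riemannExistence_of_smooth`,
the shape of SGA1 XIII Prop. 4.6; `Theorems.linearSystemTorelli_connectedWeakDescent_of_descent`). -/
theorem stub_connectedWeakDescentQbar_of_descent
    (hDescent : ∀ (σ : AlgebraicClosure ℚ →+* ℂ) (S₀ : SchemeOver (AlgebraicClosure ℚ)),
      IsQuasiProjectiveOver S₀ → IrreducibleSpace S₀.left →
      ∀ ⦃S' : SchemeOver ℂ⦄ (g : S' ⟶ (baseChangeHom σ).obj S₀),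
        IsFinite g.left → Etale g.left → ConnectedSpace S'.left →
        ∃ (S''₀ : SchemeOver (AlgebraicClosure ℚ)) (g₀ : S''₀ ⟶ S₀)
          (e : (baseChangeHom σ).obj S''₀ ≅ S'),
          IsFinite g₀.left ∧ Etale g₀.left ∧ e.hom ≫ g = (baseChangeHom σ).map g₀) :
    ∀ (σ : AlgebraicClosure ℚ →+* ℂ) (S₀ : SchemeOver (AlgebraicClosure ℚ)),
      IsQuasiProjectiveOver S₀ → IrreducibleSpace S₀.left → AlgebraicGeometry.Smooth S₀.hom →
      ∀ ⦃S' : SchemeOver ℂ⦄ (g : S' ⟶ (baseChangeHom σ).obj S₀),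
        IsFinite g.left → Etale g.left → IrreducibleSpace S'.left →
        ConnectedSpace (ComplexPoints S') →
        ∃ (S''₀ : SchemeOver (AlgebraicClosure ℚ)) (g₀ : S''₀ ⟶ S₀)
          (Ψ : ComplexPoints ((baseChangeHom σ).obj S''₀) ≃ₜ ComplexPoints S'),
          IsFinite g₀.left ∧ Etale g₀.left ∧
            ∀ z, AlgPoints.map g (Ψ z) = AlgPoints.map ((baseChangeHom σ).map g₀) z :=
  Theorems.linearSystemTorelli_connectedWeakDescent_of_descent hDescent

/-- With v6's unrestricted weak descent the v6 derivation of C (the tree's p121703) is recovered, so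
nothing consumed by B changed. -/
theorem stub_riemannExistenceQbarDescent_of_weakDescent
    (hRiemann : Literature.AlgebraicGeometry.FundamentalGroup.riemannExistence_finiteCovering)
    (hDescent : ∀ (σ : AlgebraicClosure ℚ →+* ℂ) (S₀ : SchemeOver (AlgebraicClosure ℚ)),
      IsQuasiProjectiveOver S₀ → IrreducibleSpace S₀.left → AlgebraicGeometry.Smooth S₀.hom →
      ∀ ⦃S' : SchemeOver ℂ⦄ (g : S' ⟶ (baseChangeHom σ).obj S₀),
        IsFinite g.left → Etale g.left →
        ∃ (S''₀ : SchemeOver (AlgebraicClosure ℚ)) (g₀ : S''₀ ⟶ S₀)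
          (Ψ : ComplexPoints ((baseChangeHom σ).obj S''₀) ≃ₜ ComplexPoints S'),
          IsFinite g₀.left ∧ Etale g₀.left ∧
            ∀ z, AlgPoints.map g (Ψ z) = AlgPoints.map ((baseChangeHom σ).map g₀) z) :
    Literature.AlgebraicGeometry.FundamentalGroup.riemannExistence_qbarDescent_of_finiteIndex :=
  Literature.AlgebraicGeometry.FundamentalGroup.riemannExistence_qbarDescent_of_finiteIndex_of_riemannExistence_of_weakDescent
    hRiemann hDescent

end Summit.HodgeConjecture.HodgeConjecture.Cruxes.MiddleDivisorSupportFourfold.WeaklyNonFactorDescent
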